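import Literature.MathematicalPhysics.QuantumFieldTheory.Balaban1983to89.B13Term214ParamHolo

/-!
# `Balaban1983to89.B13Term214WindowDilated` — T. Bałaban, *Renormalization group approach to lattice gauge field theories.
II. Cluster expansions*, Commun. Math. Phys. **116** (1988) 1–22 [Balaban1988RG2Cluster], pp. 15–17, with [Balaban1987RG1]
(2.10)–(2.12) p. 267: the generic term (2.14) along the WINDOW-DILATED FAMILY — the interior fluctuation field dilated by a
REAL window point (`B = g_kB′` of [I] p. 267 at a fixed real `g_k = s₀`), a complex number `b` (for the consumer: `b = s₀/u`,
`u` a complex last coupling near `s₀`) then entering the unit-temperature display POLYNOMIALLY: precision `b²·A(σ)`, cross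
kernel `b·G(σ)`, potentials `b²·W + O` — and print's (2.14)–(2.26) chain run VERBATIM on that family, pointwise in `b`, with
the (2.16)-letters inflated by `O(|b − 1|)·K`: the bound (2.26) in the torus resummation's spelling and the holomorphy in `b`,
each ONE application of a landed theorem

statement-level skeleton of published theorems with citation tags; proofs where landed; nothing here is a claim about the
Yang–Mills mass gap

PDF held: `paper:balaban1988-cmp116-rg-ii-cluster` (journal page = PDF page + 0), pp. 15–17 quoted in full in `B13Term214`,
`B13FirstEstimate215`, `B13Bound226Primitive`, `B13Lemma3TorusPrimitive`; `paper:balaban1987-cmp109-rg-i` p. 267 (render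
`b2b-balaban-ref1/pages/1987-cmp109-rg-I-small-field/…-p020-x2.png`, journal page = render page + 248).

CITATION HEADER.  [I] p. 267 [PDF 20] (after (2.10)): *"scaling transformation B = g_kB′"*; (2.12): *"the measure becomes a
Gaussian measure in variables B, with the covariance C^{(k)} = C^{(k)}(U_{k+1}) = (C\*Δ^{(k)}C)^{−1}"* with the coupling as the
explicit prefactor `1/g_k²` of the terms under the exponential.  [II] p. 15 [PDF 15]: (2.14) and *"We consider it as an analytic
function of (𝐔, 𝐉) in the space 𝐔ᶜ_{k+1}(X, α₀, α₁), and of the complex parameters σ(Z), τ. … The first estimate is (2.15) … In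
the expression on the right-hand side we replace the operators by the corresponding operators with σ(Z) = 0, 𝐔 = U, 𝐉 = 0, and
we estimate the error"*; p. 16 (2.16) *"|R₁(b, b′)| ≦ (O(1)e^{−⅓δ₀M} + O(α₀ + α₁)) exp(−½δ₀|b₋ − b′₋|)"*; p. 17 (2.26).  Print runs
the chain at REAL coupling; a complex last coupling is NOT PRINTED.  What this file records is that nothing new is needed for
it: after the real dilation `B = s₀B′` the complex coupling `u` near `s₀` is the complex number `b = s₀/u` near `1` multiplying
the interior precision (`b²`), the cross kernel (`b`) and the Wilson part of the potentials (`b²`), the exterior white noise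
`X`, the small-field boxes and the older terms being `b`-free — a family of (2.14) displays to which (2.15)–(2.26) apply at
each `b` with print's own (2.16) difference device absorbing `b − 1` as one more difference.

PROVENANCE.  §1–§3 are the tree twins, with per-declaration credit, of the memo-only sketch
`run/shared/lean/pub/pub-ymgap/ym-lens-BalabanUVNodes-transfer/lean/LensTransferSketch11.lean` (seat
`ym-lens-BalabanUVNodes-transfer` g11, sha16 `912c1eb03d980d12`, Card T20 of `LENS-transfer.md` §17 *«dilate the interior
field by the window point s₀, not by ‖u‖»*), which located this road for node N10's lane; §4 is the pair of torus-level
applications that sketch names and does not type (its §C is the one-σ core), with the positivity `Re(b²A(σ)) ≻ 0` on the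
ball DERIVED from the transported (2.16)-letter (`posDef_re_of_form`) instead of displayed.  Sibling in `t = 1/g²` coordinates
on a one-block model: `T4ComplexDilation` (cell `pub-balaban`).  Cell `pub-ymgap`, seat `pub-ymgap-dag-n10-c` (g6), node N10
[B13] of the BalabanUVNodes table; consumer: node N22's per-term schemas (S-last-T′)∕(S-226-T′) at complex last coupling on
the relative discs `closedBall (s₀:ℂ) (c_A·s₀)` (`Summits/…/BalabanUVNodesN22W1RelCentredTermDatum214[Generated]`, binders
`hlast`∕`hprop`), whose producer is unowned.

WHAT IS HERE (no definition; every statement over `B13Term214`'s objects).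
* §1 REAL INTERIOR DILATION: `cgaussMean_sq_smul` (`∫dμ_{(r²M)⁻¹}Ψ = ∫dμ_{M⁻¹}Ψ(r⁻¹·)`, any complex precision, real
  `r ≠ 0`), `inv_smul_eq`, `integrand214_dilate` (`integrand214 (r²A) (rΓ) F = integrand214 A Γ (F ∘ (r⁻¹·))`, the exterior
  `X` untouched, the compensator `½⟨rΓX,(r²A)⁻¹rΓX⟩` r-free), `core214_dilate`, `term214_dilate` — the algebra of `B = g_kB′`:
  at a REAL member `b = s₀/s` the family is the display at coupling `s` (the consumer's `hagree`); `core214_dilate_family`,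
  `term214_dilate_family` — rescaling `b ↦ rb` by a real `r` is a dilation of the last line (base-point independence).
* §2 THE BALL `|b − 1| < ρ_b`: norm bookkeeping; the LETTER TRANSPORT from the supplier's letters at `b = 1` — `(K_G, K_{Cσ},
  θ_Γ, θ_C, θ_E)` of `B13Bound226Primitive` plus ONE extra primitive letter `K_E` (entrywise decay of the reference precision
  `C⁻¹`, the restricted fluctuation operator at `(U, 0)`) — to letters uniform on the ball: `K_G ↦ (1+ρ_b)K_G`,
  `θ_Γ ↦ θ_Γ + ρ_bK_G`, `K_{Cσ} ↦ (1−ρ_b)⁻²K_{Cσ}`, `θ_C ↦ θ_C + ρ_b(2+ρ_b)(1−ρ_b)⁻²K_{Cσ}`, `θ_E ↦ θ_E + ρ_b(2+ρ_b)(θ_E + K_E)`;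
  (2.20) with `(a₂₀, w) ↦ (1+ρ_b)²(a₂₀, w)` (`h220_dilate`); and `posDef_re_of_form`: `Re A′ ≻ 0` for a complex symmetric `A′`
  from `C ≻ 0`, `λ_k(C) ≤ c` and the `R₂`-form smallness (print p. 16's perturbative regime, now a theorem of the letters).
* §3 WINDOW GEOMETRY: the coupling disc `‖u − s₀‖ ≤ c·s₀` maps into the ball `‖s₀/u − 1‖ ≤ c/(1−c)` (`norm_div_sub_one_le`,
  `div_mem_ball_of_mem_closedBall`); holomorphy in `b` on the ball ⇒ holomorphy in `u` on the disc
  (`differentiableOn_closedBall_of_ball`).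
* §4 ON THE TWO-SCALE TORUS, from the PRIMITIVE letters at `b = 1` + `K_E` + the inflation inequalities, with NO positivity
  hypothesis on the dilated precision: `h226_torus_windowDilated_of_primitives` — for every `b` of the ball, (2.26) for the
  term along the family in the spelling `‖(2.14)_b‖ ≤ weight L M c Z a t · exp(a₅|Z|)` of `B13Lemma3TorusTerms.hrep_of_termwise`
  (ONE application of `B13Lemma3TorusPrimitivePoly.h226_torus_of_primitives_holo_polyτ`; the price of `b ≠ 1` is booked
  linearly by the volume hypothesis `hvol` in the inflated letters); `differentiableOn_term214_torus_windowDilated_of_primitives`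
  — `b ↦ (2.14)_b` is complex differentiable on the ball (ONE application of
  `B13Term214ParamHolo.differentiableOn_term214_torus_param_of_primitives_holo_polyτ`, the family being polynomial in `b`).
* §5 (v1.1, append-only) THE HISTORY DIRECTION: `differentiableOn_term214_torus_windowDilated_history_of_primitives` — at a
  fixed member `b` of the ball, `p ↦ (2.14)_b` is complex differentiable in any external parameter `p` entering the older terms
  `O_p` only (ONE application of `B13Term214ParamHolo.differentiableOn_term214_torus_of_primitives_holo_polyτ` at the dilated
  kernels) — node N22's (S-226-T′) at fixed complex coupling along a holomorphic curve of older terms.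
* §6 (v1.1) CHANGING THE BASE POINT: `F214_basePoint`, `term214_windowDilated_basePoint` — two window points `s₀`, `s₁` see
  the same complex coupling `u` through the REAL ratio `r = s₁/s₀` (`s₁/u = r·(s₀/u)`); under the dilation covariance of the
  last-line data the `s₁`-family at `rb` is the `s₀`-family at `b` for every complex `b` — the continued family is ONE function
  of the coupling (node N22's junction demand), by `term214_dilate_family`, no identity theorem.
* §7 (v1.1) THE REAL-WINDOW AGREEMENT: `F214_dilationCovariant`, `term214_eq_windowDilated_of_dilationCovariant` — under the
  dilation covariance of the last-line data (`χ_s(B) = χ_{s₀}((s/s₀)B)`, `𝐕_s(Y,B) = (s₀/s)²W(Y,(s/s₀)B) + O(Y,(s/s₀)B)`) the (2.14)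
  term at coupling `s` IS the `s₀`-family at the real member `b = s₀/s` (node N22's `hagree`, modulo that displayed law).
HONEST SCOPE.  Located algebra and three applications of landed theorems; no estimate new in kind.  The identification of
the family with the pre-scaling display (2.10) of [I] read at complex coupling, and with a term tower's keyed display on the
real window, is the PRODUCER's statement (node N09 ∕ the definers of the term datum), for which §1 is the algebra; the
older terms are taken `b`-free (`O`) and the Wilson part `b²`-homogeneous (`W`) — a producer whose potentials carry the
coupling otherwise says so.  Nothing of Bałaban's kernels is constructed; every letter is a hypothesis about them.  No
`sorry`, no definition, no new named fact (D-0026).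
-/

noncomputable section

namespace Literature.MathematicalPhysics.QuantumFieldTheory.Balaban1983to89.B13Term214WindowDilated

open Matrix MeasureTheory Finset Complex Metric Set
open scoped Real
open B13PerturbativeStep (WeightHyp)
open B13Term214 (cquad cgaussWeight cgaussInt cgaussNorm cgaussMean integrand214 core214 F214 term214)
open B13Integral223 (inv_quadForm_ge dotProduct_self_pos')
open B13Bound226Located (hR2_of_entrywise entry_bound_mono_rate kc_l1_nonneg)
open B13Lemma3TorusPrimitive (weightHyp_tdist1 tdist1_symm kc_tdist1)
open B13Lemma3TorusPrimitivePoly (h226_torus_of_primitives_holo_polyτ)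
open B13Term214ParamHolo (differentiableOn_term214_torus_param_of_primitives_holo_polyτ)
open TreeLengthTorus (TPt TDom tsys)
open TreeLengthTorusTransfer (tclosure)
open B13Lemma3TorusData (TBond)
open B13Lemma3TorusTerms (weight Z0)
open B13Bound143 (invTau)
open B5TorusCover (UT)
open B9Thm37GlueTorus (tdist1)

variable {Λ : Type} [Fintype Λ] [DecidableEq Λ]

/-! ## §1. Real interior dilation of lines 2–3 of (2.14): the algebra of `B = g_kB′` -/

omit [DecidableEq Λ] in
/-- `⟨v, (cM)v⟩ = c⟨v, Mv⟩` (lens Sketch11 `cquad_smul`). [cite: Balaban1988RG2Cluster, (2.14) p.15] (elementary API for (2.14)) -/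
theorem cquad_smul (c : ℂ) (M : Matrix Λ Λ ℂ) (v : Λ → ℝ) : cquad (c • M) v = c * cquad M v := by
  simp only [cquad, Matrix.smul_apply, smul_eq_mul, Finset.mul_sum]
  exact Finset.sum_congr rfl fun i _ => Finset.sum_congr rfl fun j _ => by ring

omit [DecidableEq Λ] in
/-- `⟨rv, M(rv)⟩ = r²⟨v, Mv⟩` (lens Sketch11 `cquad_smul_field`). [cite: Balaban1988RG2Cluster, (2.14) p.15] (elementary API for (2.14)) -/
theorem cquad_smul_field (M : Matrix Λ Λ ℂ) (r : ℝ) (v : Λ → ℝ) :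
    cquad M (r • v) = (r : ℂ) ^ 2 * cquad M v := by
  simp only [cquad, Pi.smul_apply, smul_eq_mul, Complex.ofReal_mul, Finset.mul_sum]
  exact Finset.sum_congr rfl fun i _ => Finset.sum_congr rfl fun j _ => by ring

omit [DecidableEq Λ] in
/-- Scaling the precision by `r²` = dilating the field by `r` in the complex Gaussian weight (lens Sketch11
`cgaussWeight_sq_smul`). [cite: Balaban1988RG2Cluster, (2.14) p.15] (elementary API for (2.14)) -/
theorem cgaussWeight_sq_smul (M : Matrix Λ Λ ℂ) (r : ℝ) (v : Λ → ℝ) :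
    cgaussWeight ((r : ℂ) ^ 2 • M) v = cgaussWeight M (r • v) := by
  rw [cgaussWeight, cgaussWeight, cquad_smul, cquad_smul_field]

omit [DecidableEq Λ] in
/-- **Dilation invariance of the complex Gaussian MEAN** (lens Sketch10∕11 `cgaussMean_sq_smul`): for ANY complex precision
`M` and real `r ≠ 0`, `∫dμ_{(r²M)⁻¹}(B) Ψ(B) = ∫dμ_{M⁻¹}(B) Ψ(r⁻¹B)` — the Jacobians of numerator and normalisation cancel (no
hypothesis on `M`; Mathlib `Measure.integral_comp_smul`).  The change of variables `B = g_kB′` of [I] p. 267 for the complex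
measure `dμ_{C^{(k)}(Z₀,σ(Z))}` of (2.14). [cite: Balaban1987RG1, (2.10)-(2.12) p.267] -/
theorem cgaussMean_sq_smul (M : Matrix Λ Λ ℂ) {r : ℝ} (hr : r ≠ 0) (Ψ : (Λ → ℝ) → ℂ) :
    cgaussMean ((r : ℂ) ^ 2 • M) Ψ = cgaussMean M (fun v => Ψ (r⁻¹ • v)) := by
  have hI : cgaussInt ((r : ℂ) ^ 2 • M) Ψ
      = |(r ^ Module.finrank ℝ (Λ → ℝ))⁻¹| • cgaussInt M (fun v => Ψ (r⁻¹ • v)) := by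
    rw [cgaussInt, cgaussInt, ← Measure.integral_comp_smul volume _ r]
    refine integral_congr_ae (Filter.Eventually.of_forall fun v => ?_)
    simp only [cgaussWeight_sq_smul, smul_smul, inv_mul_cancel₀ hr, one_smul]
  have hN : cgaussNorm ((r : ℂ) ^ 2 • M) = |(r ^ Module.finrank ℝ (Λ → ℝ))⁻¹| • cgaussNorm M := by
    rw [cgaussNorm, cgaussNorm, ← Measure.integral_comp_smul volume _ r]
    refine integral_congr_ae (Filter.Eventually.of_forall fun v => ?_)
    simp only [cgaussWeight_sq_smul]
  have hc : ((|(r ^ Module.finrank ℝ (Λ → ℝ))⁻¹| : ℝ) : ℂ) ≠ 0 :=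
    Complex.ofReal_ne_zero.2 (abs_ne_zero.2 (inv_ne_zero (pow_ne_zero _ hr)))
  rw [cgaussMean, cgaussMean, hI, hN, Complex.real_smul, Complex.real_smul, mul_inv]
  calc _ = ((((|(r ^ Module.finrank ℝ (Λ → ℝ))⁻¹| : ℝ) : ℂ))⁻¹ * ((|(r ^ Module.finrank ℝ (Λ → ℝ))⁻¹| : ℝ) : ℂ))
        * ((cgaussNorm M)⁻¹ * cgaussInt M fun v => Ψ (r⁻¹ • v)) := by ring
    _ = _ := by rw [inv_mul_cancel₀ hc, one_mul]

omit [Fintype Λ] [DecidableEq Λ] in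
/-- `(cA)⁻¹ = c⁻¹A⁻¹` for a non-zero scalar and ANY square matrix (both sides are the junk `0` when `det A = 0`; lens
Sketch11 `inv_smul_of_ne_zero`). [folklore] [cite: Balaban1988RG2Cluster, (2.14) p.15] (elementary API for (2.14)) -/
theorem inv_smul_eq {n : Type*} [Fintype n] [DecidableEq n] {c : ℂ} (hc : c ≠ 0) (A : Matrix n n ℂ) :
    (c • A)⁻¹ = c⁻¹ • A⁻¹ := by
  by_cases hA : IsUnit A.det
  · have h := Matrix.inv_smul' (A := A) (Units.mk0 c hc) hA
    simp only [Units.smul_def, Units.val_mk0, Units.val_inv_eq_inv_val] at h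
    exact h
  · have hcA : ¬IsUnit (c • A).det := by
      rw [det_smul, isUnit_iff_ne_zero, not_ne_iff, mul_eq_zero]
      exact Or.inr (not_ne_iff.1 (fun h => hA (isUnit_iff_ne_zero.2 h)))
    rw [nonsing_inv_apply_not_isUnit _ hA, nonsing_inv_apply_not_isUnit _ hcA, smul_zero]

variable {C₀ : Type}

omit [Fintype Λ] [DecidableEq Λ] in
/-- The coerced field is linear under real dilation: `↑(rv) = r·↑v` (plumbing).
[folklore] [cite: Balaban1988RG2Cluster, (2.14) p.15] (elementary API for (2.14)) -/
theorem ofReal_smul_eq (r : ℝ) (v : Λ → ℝ) : (fun i => (((r • v) i : ℝ) : ℂ)) = (r : ℂ) • fun i => (v i : ℂ) := by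
  funext i
  simp [Pi.smul_apply, smul_eq_mul, Complex.ofReal_mul]

/-- **REAL INTERIOR DILATION of lines 2–3 of (2.14)** (lens Sketch11 `integrand214_dilate`).  Scaling the interior precision
`A = C^{(k)}(Z₀,σ(Z))⁻¹` by `r²` and the cross kernel `Γ = Γ_k(Z₀,σ(Z))` by `r` (`r` real, non-zero; the exterior white noise
`X` untouched) is the dilation `B ↦ r⁻¹B` of the interior field in the last line: the compensator
`exp(−½⟨rΓX, (r²A)⁻¹rΓX⟩) = exp(−½⟨ΓX, A⁻¹ΓX⟩)` is `r`-free and `⟨r⁻¹B, rΓX⟩ = ⟨B, ΓX⟩` — [I] p. 267's `B = g_kB′` read on the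
(2.14) display. [cite: Balaban1987RG1, (2.10)-(2.12) p.267; Balaban1988RG2Cluster, (2.14) p.15] -/
theorem integrand214_dilate (A : Matrix Λ Λ ℂ) (Γ : (Λ ⊕ C₀ → ℝ) → (Λ → ℂ)) (F : (Λ → ℝ) → ℂ) {r : ℝ} (hr : r ≠ 0)
    (X : Λ ⊕ C₀ → ℝ) :
    integrand214 ((r : ℂ) ^ 2 • A) (fun X => (r : ℂ) • Γ X) F X = integrand214 A Γ (fun B => F (r⁻¹ • B)) X := by
  have hrc : (r : ℂ) ≠ 0 := Complex.ofReal_ne_zero.2 hr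
  have hr2 : (r : ℂ) ^ 2 ≠ 0 := pow_ne_zero 2 hrc
  have hcomp : ((r : ℂ) • Γ X) ⬝ᵥ ((((r : ℂ) ^ 2 • A)⁻¹) *ᵥ ((r : ℂ) • Γ X)) = Γ X ⬝ᵥ (A⁻¹ *ᵥ Γ X) := by
    rw [inv_smul_eq hr2, Matrix.smul_mulVec, Matrix.mulVec_smul, smul_dotProduct, dotProduct_smul, dotProduct_smul,
      smul_eq_mul, smul_eq_mul, smul_eq_mul,
      show (r : ℂ) * ((((r : ℂ) ^ 2)⁻¹) * ((r : ℂ) * (Γ X ⬝ᵥ (A⁻¹ *ᵥ Γ X))))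
        = ((r : ℂ) ^ 2 * ((r : ℂ) ^ 2)⁻¹) * (Γ X ⬝ᵥ (A⁻¹ *ᵥ Γ X)) by ring,
      mul_inv_cancel₀ hr2, one_mul]
  unfold integrand214
  rw [hcomp, cgaussMean_sq_smul A hr]
  refine congrArg _ (congrArg (cgaussMean A) (funext fun v => ?_))
  show Complex.exp (-((fun i => (((r⁻¹ • v) i : ℝ) : ℂ)) ⬝ᵥ ((r : ℂ) • Γ X))) * F (r⁻¹ • v)
    = Complex.exp (-((fun i => ((v i : ℝ) : ℂ)) ⬝ᵥ Γ X)) * F (r⁻¹ • v)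
  rw [ofReal_smul_eq, smul_dotProduct, dotProduct_smul, smul_eq_mul, smul_eq_mul, ← mul_assoc, Complex.ofReal_inv,
    inv_mul_cancel₀ hrc, one_mul]

/-- The `X`-integral of (2.14) under the real interior dilation (σ-families; pointwise `integrand214_dilate`; lens Sketch11
`core214_dilate`). [cite: Balaban1987RG1, (2.10)-(2.12) p.267; Balaban1988RG2Cluster, (2.14) p.15] -/
theorem core214_dilate [Fintype C₀] [DecidableEq C₀] {ι D : Type*} (A : (ι → ℂ) → Matrix Λ Λ ℂ)
    (Γ : (ι → ℂ) → (Λ ⊕ C₀ → ℝ) → (Λ → ℂ)) (F : (D → ℂ) → (Λ → ℝ) → ℂ) {r : ℝ} (hr : r ≠ 0) (σ : ι → ℂ) (τ : D → ℂ) :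
    core214 (fun σ => (r : ℂ) ^ 2 • A σ) (fun σ X => (r : ℂ) • Γ σ X) F σ τ
      = core214 A Γ (fun τ B => F τ (r⁻¹ • B)) σ τ := by
  unfold core214
  exact congrArg (cgaussMean 1) (funext fun X => integrand214_dilate (A σ) (Γ σ) (F τ) hr X)

/-- **The term (2.14) under the real interior dilation**: scaling the interior precision family by `r²` and the cross
operator by `r` equals dilating the interior field in the last line by `r⁻¹` — so the window-dilated family at a REAL
member `b = s₀/s` is the (2.14) display at coupling `s` once the last line is keyed accordingly (the consumer's `hagree`;
lens Sketch11 `term214_dilate`). [cite: Balaban1987RG1, (2.10)-(2.12) p.267; Balaban1988RG2Cluster, (2.14) p.15] -/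
theorem term214_dilate [Fintype C₀] [DecidableEq C₀] {ι D : Type*} [DecidableEq ι] [DecidableEq D] (rr : ℝ)
    (lZ : List ι) (lD : List D) (A : (ι → ℂ) → Matrix Λ Λ ℂ) (Γ : (ι → ℂ) → (Λ ⊕ C₀ → ℝ) → (Λ → ℂ))
    (F : (D → ℂ) → (Λ → ℝ) → ℂ) {r : ℝ} (hr : r ≠ 0) (σ₀ : ι → ℂ) (τ₀ : D → ℂ) :
    term214 rr lZ lD (core214 (fun σ => (r : ℂ) ^ 2 • A σ) (fun σ X => (r : ℂ) • Γ σ X) F) σ₀ τ₀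
      = term214 rr lZ lD (core214 A Γ (fun τ B => F τ (r⁻¹ • B))) σ₀ τ₀ := by
  have h : core214 (fun σ => (r : ℂ) ^ 2 • A σ) (fun σ X => (r : ℂ) • Γ σ X) F
      = core214 A Γ (fun τ B => F τ (r⁻¹ • B)) :=
    funext fun σ => funext fun τ => core214_dilate A Γ F hr σ τ
  rw [h]

/-- **Base-point independence of the window-dilated family** (the algebra behind «`TFc` is ONE function of the
coupling»): rescaling the family parameter by a REAL `r ≠ 0` — `b ↦ rb` in the precision (`(rb)²A`) and in the cross
operator (`(rb)Γ`) — is the interior dilation `B ↦ r⁻¹B` of the last line at the member `b` (`core214_dilate` at the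
`b`-member).  With `r = s₁/s₀` this identifies the families built at two window points `s₀`, `s₁` at the same coupling
`u` (`s₁/u = r·(s₀/u)`), once the producer's last line scales accordingly. [cite: Balaban1987RG1, (2.10)-(2.12) p.267; Balaban1988RG2Cluster, (2.14) p.15] -/
theorem core214_dilate_family [Fintype C₀] [DecidableEq C₀] {ι D : Type*} (A : (ι → ℂ) → Matrix Λ Λ ℂ)
    (Γ : (ι → ℂ) → (Λ ⊕ C₀ → ℝ) → (Λ → ℂ)) (F : (D → ℂ) → (Λ → ℝ) → ℂ) {r : ℝ} (hr : r ≠ 0) (b : ℂ) (σ : ι → ℂ)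
    (τ : D → ℂ) :
    core214 (fun σ => ((r : ℂ) * b) ^ 2 • A σ) (fun σ X => ((r : ℂ) * b) • Γ σ X) F σ τ
      = core214 (fun σ => b ^ 2 • A σ) (fun σ X => b • Γ σ X) (fun τ B => F τ (r⁻¹ • B)) σ τ := by
  have h1 : (fun σ => ((r : ℂ) * b) ^ 2 • A σ) = fun σ => (r : ℂ) ^ 2 • (b ^ 2 • A σ) :=
    funext fun σ => by rw [mul_pow, mul_smul]
  have h2 : (fun σ X => ((r : ℂ) * b) • Γ σ X) = fun σ X => (r : ℂ) • (b • Γ σ X) :=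
    funext fun σ => funext fun X => by rw [mul_smul]
  rw [h1, h2]
  exact core214_dilate (fun σ => b ^ 2 • A σ) (fun σ X => b • Γ σ X) F hr σ τ

/-- The term-level form of `core214_dilate_family`. [cite: Balaban1987RG1, (2.10)-(2.12) p.267; Balaban1988RG2Cluster, (2.14) p.15] -/
theorem term214_dilate_family [Fintype C₀] [DecidableEq C₀] {ι D : Type*} [DecidableEq ι] [DecidableEq D] (rr : ℝ)
    (lZ : List ι) (lD : List D) (A : (ι → ℂ) → Matrix Λ Λ ℂ) (Γ : (ι → ℂ) → (Λ ⊕ C₀ → ℝ) → (Λ → ℂ))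
    (F : (D → ℂ) → (Λ → ℝ) → ℂ) {r : ℝ} (hr : r ≠ 0) (b : ℂ) (σ₀ : ι → ℂ) (τ₀ : D → ℂ) :
    term214 rr lZ lD (core214 (fun σ => ((r : ℂ) * b) ^ 2 • A σ) (fun σ X => ((r : ℂ) * b) • Γ σ X) F) σ₀ τ₀
      = term214 rr lZ lD (core214 (fun σ => b ^ 2 • A σ) (fun σ X => b • Γ σ X) (fun τ B => F τ (r⁻¹ • B))) σ₀ τ₀ := by
  have h : core214 (fun σ => ((r : ℂ) * b) ^ 2 • A σ) (fun σ X => ((r : ℂ) * b) • Γ σ X) F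
      = core214 (fun σ => b ^ 2 • A σ) (fun σ X => b • Γ σ X) (fun τ B => F τ (r⁻¹ • B)) :=
    funext fun σ => funext fun τ => core214_dilate_family A Γ F hr b σ τ
  rw [h]

/-! ## §2. The ball `|b − 1| < ρ_b`: norm bookkeeping, the letter transport, and `Re ≻ 0` from the `R₂` form -/

section Ball

variable {ρ : ℝ} {p : ℂ}

/-- `‖b − 1‖ < ρ_b` on the ball (plumbing). [folklore] [cite: Balaban1988RG2Cluster, (2.16) p.16] (elementary API for (2.16)) -/
theorem norm_sub_one_lt_of_mem_ball (hp : p ∈ ball (1 : ℂ) ρ) : ‖p - 1‖ < ρ := by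
  rwa [mem_ball, dist_eq_norm] at hp

/-- `‖b‖ ≤ 1 + ρ_b` on the ball. [folklore] [cite: Balaban1988RG2Cluster, (2.16) p.16] (elementary API for (2.16)) -/
theorem norm_le_of_mem_ball (hp : p ∈ ball (1 : ℂ) ρ) : ‖p‖ ≤ 1 + ρ := by
  have h := norm_sub_one_lt_of_mem_ball hp
  calc ‖p‖ = ‖(p - 1) + 1‖ := by rw [sub_add_cancel]
    _ ≤ ‖p - 1‖ + ‖(1 : ℂ)‖ := norm_add_le _ _
    _ ≤ 1 + ρ := by rw [norm_one]; linarith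

/-- `1 − ρ_b ≤ ‖b‖` on the ball. [folklore] [cite: Balaban1988RG2Cluster, (2.16) p.16] (elementary API for (2.16)) -/
theorem one_sub_le_norm_of_mem_ball (hp : p ∈ ball (1 : ℂ) ρ) : 1 - ρ ≤ ‖p‖ := by
  have h := norm_sub_one_lt_of_mem_ball hp
  have h1 : ‖(1 : ℂ)‖ - ‖p‖ ≤ ‖1 - p‖ := norm_sub_norm_le _ _
  rw [norm_one, norm_sub_rev] at h1
  linarith

/-- The ball is non-empty only for `ρ_b ≥ 0` (plumbing). [folklore] [cite: Balaban1988RG2Cluster, (2.16) p.16] (elementary API for (2.16)) -/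
theorem rad_nonneg_of_mem_ball (hp : p ∈ ball (1 : ℂ) ρ) : 0 ≤ ρ :=
  le_trans (norm_nonneg _) (norm_sub_one_lt_of_mem_ball hp).le

/-- `‖b²‖ ≤ (1 + ρ_b)²` on the ball. [folklore] [cite: Balaban1988RG2Cluster, (2.16) p.16] (elementary API for (2.16)) -/
theorem norm_sq_le_of_mem_ball (hp : p ∈ ball (1 : ℂ) ρ) : ‖p ^ 2‖ ≤ (1 + ρ) ^ 2 := by
  rw [norm_pow]; exact pow_le_pow_left₀ (norm_nonneg _) (norm_le_of_mem_ball hp) 2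

/-- `‖b² − 1‖ ≤ ρ_b(2 + ρ_b)` on the ball. [folklore] [cite: Balaban1988RG2Cluster, (2.16) p.16] (elementary API for (2.16)) -/
theorem norm_sq_sub_one_le_of_mem_ball (hp : p ∈ ball (1 : ℂ) ρ) : ‖p ^ 2 - 1‖ ≤ ρ * (2 + ρ) := by
  have h := norm_sub_one_lt_of_mem_ball hp
  have e : p ^ 2 - 1 = (p - 1) * (p + 1) := by ring
  have h2 : ‖p + 1‖ ≤ 2 + ρ :=
    (norm_add_le _ _).trans (by rw [norm_one]; linarith [norm_le_of_mem_ball hp])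
  rw [e, norm_mul]
  exact mul_le_mul h.le h2 (norm_nonneg _) (rad_nonneg_of_mem_ball hp)

/-- `b ≠ 0` on the ball of radius `< 1`. [folklore] [cite: Balaban1988RG2Cluster, (2.16) p.16] (elementary API for (2.16)) -/
theorem ne_zero_of_mem_ball (hρ1 : ρ < 1) (hp : p ∈ ball (1 : ℂ) ρ) : p ≠ 0 := fun h => by
  have h1 := one_sub_le_norm_of_mem_ball hp
  rw [h, norm_zero] at h1
  linarith

/-- `‖b⁻²‖ ≤ (1 − ρ_b)⁻²` on the ball of radius `< 1`. [folklore] [cite: Balaban1988RG2Cluster, (2.16) p.16] (elementary API for (2.16)) -/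
theorem norm_inv_sq_le_of_mem_ball (hρ1 : ρ < 1) (hp : p ∈ ball (1 : ℂ) ρ) : ‖(p ^ 2)⁻¹‖ ≤ ((1 - ρ) ^ 2)⁻¹ := by
  have h1 := one_sub_le_norm_of_mem_ball hp
  have h0 : 0 < 1 - ρ := by linarith
  rw [norm_inv, norm_pow]
  exact inv_anti₀ (pow_pos h0 2) (pow_le_pow_left₀ h0.le h1 2)

/-- `‖b⁻² − 1‖ ≤ ρ_b(2 + ρ_b)(1 − ρ_b)⁻²` on the ball of radius `< 1`. [folklore]
[cite: Balaban1988RG2Cluster, (2.16) p.16] (elementary API for (2.16)) -/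
theorem norm_inv_sq_sub_one_le_of_mem_ball (hρ1 : ρ < 1) (hp : p ∈ ball (1 : ℂ) ρ) :
    ‖(p ^ 2)⁻¹ - 1‖ ≤ ρ * (2 + ρ) * ((1 - ρ) ^ 2)⁻¹ := by
  have hp2 : p ^ 2 ≠ 0 := pow_ne_zero 2 (ne_zero_of_mem_ball hρ1 hp)
  have e : (p ^ 2)⁻¹ - 1 = -(p ^ 2 - 1) * (p ^ 2)⁻¹ := by
    rw [neg_mul, sub_mul, mul_inv_cancel₀ hp2, one_mul, neg_sub]
  rw [e, norm_mul, norm_neg]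
  exact mul_le_mul (norm_sq_sub_one_le_of_mem_ball hp) (norm_inv_sq_le_of_mem_ball hρ1 hp) (norm_nonneg _)
    (mul_nonneg (rad_nonneg_of_mem_ball hp) (by linarith [rad_nonneg_of_mem_ball hp]))

variable {m n : Type*}

/-- **Letter transport, cross kernel** (L17a for `b·G`): `‖(bG)(i,j)‖ ≤ (1+ρ_b)·K_G·e` (lens Sketch11 `smul_entry_le`).
[cite: Balaban1988RG2Cluster, (2.16) p.16, p.15] -/
theorem smul_entry_le {G : Matrix m n ℂ} {K : ℝ} {e : m → n → ℝ} (hG : ∀ i j, ‖G i j‖ ≤ K * e i j)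
    (hp : p ∈ ball (1 : ℂ) ρ) (i : m) (j : n) : ‖(p • G) i j‖ ≤ (1 + ρ) * K * e i j := by
  rw [Matrix.smul_apply, smul_eq_mul, norm_mul, mul_assoc]
  exact mul_le_mul (norm_le_of_mem_ball hp) (hG i j) (norm_nonneg _) (by linarith [rad_nonneg_of_mem_ball hp])

/-- **Letter transport, cross-kernel difference** ((2.16) for `bG − Γ₀`, `b − 1` as ONE MORE DIFFERENCE):
`‖(bG − Γ₀)(i,j)‖ ≤ (θ_Γ + ρ_b·K_G)·e` (lens Sketch11 `smul_sub_entry_le`). [cite: Balaban1988RG2Cluster, (2.16) p.16] -/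
theorem smul_sub_entry_le {G Γ₀ : Matrix m n ℂ} {K θ : ℝ} {e : m → n → ℝ} (hG : ∀ i j, ‖G i j‖ ≤ K * e i j)
    (hd : ∀ i j, ‖(G - Γ₀) i j‖ ≤ θ * e i j) (hp : p ∈ ball (1 : ℂ) ρ) (i : m) (j : n) :
    ‖(p • G - Γ₀) i j‖ ≤ (θ + ρ * K) * e i j := by
  have h := norm_sub_one_lt_of_mem_ball hp
  have e1 : (p • G - Γ₀) i j = (p - 1) * G i j + (G - Γ₀) i j := by
    simp only [Matrix.sub_apply, Matrix.smul_apply, smul_eq_mul]; ring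
  rw [e1]
  calc _ ≤ ‖(p - 1) * G i j‖ + ‖(G - Γ₀) i j‖ := norm_add_le _ _
    _ ≤ ρ * (K * e i j) + θ * e i j := by
        rw [norm_mul]
        exact add_le_add (mul_le_mul h.le (hG i j) (norm_nonneg _) (rad_nonneg_of_mem_ball hp)) (hd i j)
    _ = (θ + ρ * K) * e i j := by ring

/-- **Letter transport, covariance** (L17a for `(b²A)⁻¹ = b⁻²A⁻¹`): `‖(b²A)⁻¹(i,j)‖ ≤ (1−ρ_b)⁻²·K_{Cσ}·e` (lens Sketch11
`inv_sq_smul_entry_le`). [cite: Balaban1988RG2Cluster, (2.16) p.16, p.15] -/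
theorem inv_sq_smul_entry_le [Fintype m] [DecidableEq m] {A : Matrix m m ℂ} {K : ℝ} {e : m → m → ℝ}
    (hA : ∀ i j, ‖A⁻¹ i j‖ ≤ K * e i j) (hρ1 : ρ < 1) (hp : p ∈ ball (1 : ℂ) ρ) (i j : m) :
    ‖(p ^ 2 • A)⁻¹ i j‖ ≤ ((1 - ρ) ^ 2)⁻¹ * K * e i j := by
  have hp2 : p ^ 2 ≠ 0 := pow_ne_zero 2 (ne_zero_of_mem_ball hρ1 hp)
  rw [inv_smul_eq hp2, Matrix.smul_apply, smul_eq_mul, norm_mul, mul_assoc]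
  exact mul_le_mul (norm_inv_sq_le_of_mem_ball hρ1 hp) (hA i j) (norm_nonneg _) (by positivity)

/-- **Letter transport, covariance difference** ((2.16) for `(b²A)⁻¹ − C`):
`‖((b²A)⁻¹ − C)(i,j)‖ ≤ (θ_C + ρ_b(2+ρ_b)(1−ρ_b)⁻²·K_{Cσ})·e` (lens Sketch11 `inv_sq_smul_sub_entry_le`).
[cite: Balaban1988RG2Cluster, (2.16) p.16] -/
theorem inv_sq_smul_sub_entry_le [Fintype m] [DecidableEq m] {A Cc : Matrix m m ℂ} {K θ : ℝ} {e : m → m → ℝ}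
    (hA : ∀ i j, ‖A⁻¹ i j‖ ≤ K * e i j) (hd : ∀ i j, ‖(A⁻¹ - Cc) i j‖ ≤ θ * e i j) (hρ1 : ρ < 1)
    (hp : p ∈ ball (1 : ℂ) ρ) (i j : m) :
    ‖((p ^ 2 • A)⁻¹ - Cc) i j‖ ≤ (θ + ρ * (2 + ρ) * ((1 - ρ) ^ 2)⁻¹ * K) * e i j := by
  have hp2 : p ^ 2 ≠ 0 := pow_ne_zero 2 (ne_zero_of_mem_ball hρ1 hp)
  have e1 : ((p ^ 2 • A)⁻¹ - Cc) i j = ((p ^ 2)⁻¹ - 1) * A⁻¹ i j + (A⁻¹ - Cc) i j := by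
    rw [inv_smul_eq hp2]
    simp only [Matrix.sub_apply, Matrix.smul_apply, smul_eq_mul]; ring
  rw [e1]
  calc _ ≤ ‖((p ^ 2)⁻¹ - 1) * A⁻¹ i j‖ + ‖(A⁻¹ - Cc) i j‖ := norm_add_le _ _
    _ ≤ ρ * (2 + ρ) * ((1 - ρ) ^ 2)⁻¹ * (K * e i j) + θ * e i j := by
        rw [norm_mul]
        exact add_le_add (mul_le_mul (norm_inv_sq_sub_one_le_of_mem_ball hρ1 hp) (hA i j) (norm_nonneg _)
          (by have := rad_nonneg_of_mem_ball hp; positivity)) (hd i j)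
    _ = _ := by ring

/-- **Letter transport, precision difference** ((2.16) for `b²A − C⁻¹`): `‖(b²A − C⁻¹)(i,j)‖ ≤ (θ_E + ρ_b(2+ρ_b)(θ_E + K_E))·e` —
uses the ONE extra primitive letter, the entrywise decay `K_E` of the reference precision `C⁻¹` (lens Sketch11
`sq_smul_sub_entry_le`). [cite: Balaban1988RG2Cluster, (2.16) p.16] -/
theorem sq_smul_sub_entry_le {A Cinv : Matrix m m ℂ} {KE θ : ℝ} {e : m → m → ℝ}
    (hE : ∀ i j, ‖Cinv i j‖ ≤ KE * e i j) (hd : ∀ i j, ‖(A - Cinv) i j‖ ≤ θ * e i j)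
    (hp : p ∈ ball (1 : ℂ) ρ) (i j : m) :
    ‖(p ^ 2 • A - Cinv) i j‖ ≤ (θ + ρ * (2 + ρ) * (θ + KE)) * e i j := by
  have hAij : ‖A i j‖ ≤ (θ + KE) * e i j := by
    have e2 : A i j = (A - Cinv) i j + Cinv i j := by simp only [Matrix.sub_apply]; ring
    rw [e2]
    calc _ ≤ ‖(A - Cinv) i j‖ + ‖Cinv i j‖ := norm_add_le _ _
      _ ≤ θ * e i j + KE * e i j := add_le_add (hd i j) (hE i j)
      _ = _ := by ring
  have e1 : (p ^ 2 • A - Cinv) i j = (p ^ 2 - 1) * A i j + (A - Cinv) i j := by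
    simp only [Matrix.sub_apply, Matrix.smul_apply, smul_eq_mul]; ring
  rw [e1]
  calc _ ≤ ‖(p ^ 2 - 1) * A i j‖ + ‖(A - Cinv) i j‖ := norm_add_le _ _
    _ ≤ ρ * (2 + ρ) * ((θ + KE) * e i j) + θ * e i j := by
        rw [norm_mul]
        exact add_le_add (mul_le_mul (norm_sq_sub_one_le_of_mem_ball hp) hAij (norm_nonneg _)
          (by have := rad_nonneg_of_mem_ball hp; positivity)) (hd i j)
    _ = _ := by ring

omit [DecidableEq Λ] in
/-- **(2.20) transport**: with the Wilson part of the potentials multiplied by `b²` and the older terms `b`-free,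
`Σ|τ(Y)||b²W + O| ≤ (1+ρ_b)²·(½a₂₀‖B‖² + w)` from the joint (2.20) shape of `|W| + |O|` (lens Sketch11 `h220_dilate`).
[cite: Balaban1988RG2Cluster, (2.20) p.16] -/
theorem h220_dilate {κ : Type*} (Dfam : Finset κ) (τ : κ → ℂ) {W O : κ → (Λ → ℝ) → ℂ} {a w : ℝ}
    (h : ∀ B, ∑ Y ∈ Dfam, ‖τ Y‖ * (‖W Y B‖ + ‖O Y B‖) ≤ a / 2 * (B ⬝ᵥ B) + w) (hp : p ∈ ball (1 : ℂ) ρ)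
    (B : Λ → ℝ) :
    ∑ Y ∈ Dfam, ‖τ Y‖ * ‖p ^ 2 * W Y B + O Y B‖ ≤ ((1 + ρ) ^ 2 * a) / 2 * (B ⬝ᵥ B) + (1 + ρ) ^ 2 * w := by
  have hρ := rad_nonneg_of_mem_ball hp
  have h1 : (1 : ℝ) ≤ (1 + ρ) ^ 2 := by nlinarith
  have hp2 := norm_sq_le_of_mem_ball hp
  calc ∑ Y ∈ Dfam, ‖τ Y‖ * ‖p ^ 2 * W Y B + O Y B‖
      ≤ ∑ Y ∈ Dfam, ‖τ Y‖ * ((1 + ρ) ^ 2 * (‖W Y B‖ + ‖O Y B‖)) := Finset.sum_le_sum fun Y _ => by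
        refine mul_le_mul_of_nonneg_left ?_ (norm_nonneg _)
        calc ‖p ^ 2 * W Y B + O Y B‖ ≤ ‖p ^ 2‖ * ‖W Y B‖ + ‖O Y B‖ :=
              (norm_add_le _ _).trans (by rw [norm_mul])
          _ ≤ (1 + ρ) ^ 2 * ‖W Y B‖ + (1 + ρ) ^ 2 * ‖O Y B‖ :=
              add_le_add (mul_le_mul_of_nonneg_right hp2 (norm_nonneg _)) (le_mul_of_one_le_left (norm_nonneg _) h1)
          _ = (1 + ρ) ^ 2 * (‖W Y B‖ + ‖O Y B‖) := by ring
    _ = (1 + ρ) ^ 2 * ∑ Y ∈ Dfam, ‖τ Y‖ * (‖W Y B‖ + ‖O Y B‖) := by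
        rw [Finset.mul_sum]; exact Finset.sum_congr rfl fun Y _ => by ring
    _ ≤ (1 + ρ) ^ 2 * (a / 2 * (B ⬝ᵥ B) + w) := mul_le_mul_of_nonneg_left (h B) (by positivity)
    _ = _ := by ring

end Ball

/-- **`Re A′ ≻ 0` DERIVED from the `R₂` form** (print p. 16: the perturbative regime in which (2.15) is applied is a
consequence of (2.16)): for a complex symmetric `A′` and the reference covariance `C ≻ 0` with `λ_k(C) ≤ c`, if
`⟨B, (C⁻¹ − Re A′)B⟩ ≤ ρ‖B‖²` ((2.21) for `R₂`) and `ρc < 1` then `Re A′ ≻ 0`, indeed `⟨B, (Re A′)B⟩ ≥ (c⁻¹ − ρ)‖B‖²`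
(`B13Integral223.inv_quadForm_ge`).  Used below to discharge the positivity of the dilated precision `b²A(σ)` from the
transported (2.16)-letter. [cite: Balaban1988RG2Cluster, (2.15) p.15, (2.16) p.16, (2.24) p.17] -/
theorem posDef_re_of_form {A : Matrix Λ Λ ℂ} (hAs : A.IsSymm) {C : Matrix Λ Λ ℝ} (hC : C.PosDef) {c ρ : ℝ}
    (hc : ∀ k, hC.1.eigenvalues k ≤ c)
    (hR2 : ∀ B : Λ → ℝ, B ⬝ᵥ ((C⁻¹ - A.map Complex.re) *ᵥ B) ≤ ρ * (B ⬝ᵥ B)) (hρc : ρ * c < 1) :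
    (A.map Complex.re).PosDef := by
  refine posDef_iff_dotProduct_mulVec.2 ⟨?_, fun x hx => ?_⟩
  · show (A.map Complex.re)ᴴ = A.map Complex.re
    rw [conjTranspose_eq_transpose_of_trivial, ← Matrix.transpose_map, hAs.eq]
  · have hxx : 0 < x ⬝ᵥ x := dotProduct_self_pos' hx
    obtain ⟨i, -⟩ : ∃ i, x i ≠ 0 := Function.ne_iff.1 hx
    have hcpos : 0 < c := (hC.eigenvalues_pos i).trans_le (hc i)
    have hρ : ρ < c⁻¹ := by rw [← one_div, lt_div_iff₀ hcpos]; exact hρc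
    have hq := inv_quadForm_ge hC hc x
    have h2 := hR2 x
    rw [sub_mulVec, dotProduct_sub] at h2
    rw [star_trivial]
    nlinarith [mul_lt_mul_of_pos_right hρ hxx]

/-! ## §3. Window geometry: from the coupling disc `‖u − s₀‖ ≤ c·s₀` to the ball in `b = s₀/u` -/

/-- **The relative coupling disc maps into the ball**: `‖u − t‖ ≤ c·t` (`t > 0`, `0 ≤ c < 1`) ⇒ `‖t/u − 1‖ ≤ c/(1 − c)`
(lens Sketch11 `norm_div_sub_one_le`). [folklore] [cite: Balaban1987RG1, (2.10) p.267] -/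
theorem norm_div_sub_one_le {u : ℂ} {t c : ℝ} (ht : 0 < t) (hc0 : 0 ≤ c) (hc1 : c < 1) (h : ‖u - t‖ ≤ c * t) :
    ‖(t : ℂ) / u - 1‖ ≤ c / (1 - c) := by
  have h1 : ‖(t : ℂ)‖ - ‖u‖ ≤ ‖(t : ℂ) - u‖ := norm_sub_norm_le _ _
  rw [norm_sub_rev, Complex.norm_real, Real.norm_of_nonneg ht.le] at h1
  have hu : (1 - c) * t ≤ ‖u‖ := by nlinarith
  have h1c : (1 - c) ≠ 0 := ne_of_gt (by linarith)
  have hu0 : 0 < ‖u‖ := lt_of_lt_of_le (mul_pos (by linarith) ht) hu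
  have hune : u ≠ 0 := norm_pos_iff.1 hu0
  have e : (t : ℂ) / u - 1 = ((t : ℂ) - u) / u := by field_simp
  rw [e, norm_div, div_le_iff₀ hu0, norm_sub_rev]
  calc ‖u - (t : ℂ)‖ ≤ c * t := h
    _ = c / (1 - c) * ((1 - c) * t) := by rw [← mul_assoc, div_mul_cancel₀ c h1c]
    _ ≤ c / (1 - c) * ‖u‖ := mul_le_mul_of_nonneg_left hu (div_nonneg hc0 (by linarith))

/-- **The coupling disc lies in the window set** `{u ≠ 0, t/u ∈ ball 1 ρ_b}` as soon as `c/(1 − c) < ρ_b` (lens Sketch11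
`closedBall_subset_window`). [folklore] [cite: Balaban1987RG1, (2.10) p.267] -/
theorem closedBall_subset_window {t c ρb : ℝ} (ht : 0 < t) (hc0 : 0 ≤ c) (hc1 : c < 1) (hρb : c / (1 - c) < ρb) :
    closedBall (t : ℂ) (c * t) ⊆ {u : ℂ | u ≠ 0 ∧ (t : ℂ) / u ∈ ball (1 : ℂ) ρb} := by
  intro u hu
  rw [mem_closedBall, dist_eq_norm] at hu
  have h1 : ‖(t : ℂ)‖ - ‖u‖ ≤ ‖(t : ℂ) - u‖ := norm_sub_norm_le _ _
  rw [norm_sub_rev, Complex.norm_real, Real.norm_of_nonneg ht.le] at h1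
  have hu0 : 0 < ‖u‖ := by nlinarith [mul_pos (sub_pos.2 hc1) ht]
  refine ⟨norm_pos_iff.1 hu0, ?_⟩
  rw [mem_ball, dist_eq_norm]
  exact lt_of_le_of_lt (norm_div_sub_one_le ht hc0 hc1 hu) hρb

/-- Every coupling of the relative disc has its `b = t/u` in the ball (pointwise form of `closedBall_subset_window`, the
shape in which a bound proved for every `b` of the ball is read at every `u` of the disc).
[folklore] [cite: Balaban1987RG1, (2.10) p.267] -/
theorem div_mem_ball_of_mem_closedBall {t c ρb : ℝ} (ht : 0 < t) (hc0 : 0 ≤ c) (hc1 : c < 1) (hρb : c / (1 - c) < ρb)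
    {u : ℂ} (hu : u ∈ closedBall (t : ℂ) (c * t)) : (t : ℂ) / u ∈ ball (1 : ℂ) ρb :=
  (closedBall_subset_window ht hc0 hc1 hρb hu).2

/-- Holomorphy in `b` on the ball ⇒ holomorphy in the coupling `u` on the window set (composition with `u ↦ t/u`; lens
Sketch11 `differentiableOn_comp_window`). [folklore] [cite: Balaban1987RG1, §1 p.263 ("C^∞ (or analytic)")] -/
theorem differentiableOn_comp_window {E : Type*} [NormedAddCommGroup E] [NormedSpace ℂ E] {f : ℂ → E} {ρb : ℝ}
    (hf : DifferentiableOn ℂ f (ball (1 : ℂ) ρb)) (t : ℝ) :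
    DifferentiableOn ℂ (fun u => f ((t : ℂ) / u)) {u : ℂ | u ≠ 0 ∧ (t : ℂ) / u ∈ ball (1 : ℂ) ρb} := by
  refine hf.comp (fun u hu => ?_) (fun u hu => hu.2)
  exact ((differentiableAt_const _).div differentiableAt_id hu.1).differentiableWithinAt

/-- **Holomorphy on one coupling disc from holomorphy on the ball** — the shape of node N22's (S-last-T′): if
`c/(1 − c) < ρ_b` then `u ↦ f(t/u)` is holomorphic on the closed disc `‖u − t‖ ≤ c·t` (lens Sketch11
`differentiableOn_closedBall_of_ball`). [folklore] [cite: Balaban1987RG1, §1 p.263 ("C^∞ (or analytic)")] -/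
theorem differentiableOn_closedBall_of_ball {E : Type*} [NormedAddCommGroup E] [NormedSpace ℂ E] {f : ℂ → E}
    {ρb t c : ℝ} (hf : DifferentiableOn ℂ f (ball (1 : ℂ) ρb)) (ht : 0 < t) (hc0 : 0 ≤ c) (hc1 : c < 1)
    (hρb : c / (1 - c) < ρb) :
    DifferentiableOn ℂ (fun u => f ((t : ℂ) / u)) (closedBall (t : ℂ) (c * t)) :=
  (differentiableOn_comp_window hf t).mono (closedBall_subset_window ht hc0 hc1 hρb)

/-! ## §4. On the two-scale torus: (2.26) along the window-dilated family, and its holomorphy in `b`, from the primitive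
letters at `b = 1` -/

section Torus

variable {d L N' : ℕ} [NeZero L] [NeZero N'] {M : ℕ}
variable {ν : ℕ} {Nf : Fin ν → ℕ} [∀ i, NeZero (Nf i)]
variable {C₀ : Type} [Fintype C₀] [DecidableEq C₀]

/-- The smallness behind `Re(b²A(σ)) ≻ 0`: from the (2.24) condition `(2θ′ + γ₂ + a)·c ≤ ½` with non-negative letters,
`θ′·c < 1` (arithmetic). [cite: Balaban1988RG2Cluster, (2.24) p.17] (elementary API for (2.24)) -/
theorem theta_mul_lt_one {θ' γ a c : ℝ} (hγ : 0 ≤ γ) (ha : 0 ≤ a) (hc : 0 ≤ c)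
    (hαc : (2 * θ' + (γ + a)) * c ≤ 1 / 2) : θ' * c < 1 := by
  nlinarith [mul_nonneg (add_nonneg hγ ha) hc]

open Classical in
/-- **(2.26) ALONG THE WINDOW-DILATED FAMILY, for one term of the torus model, from the PRIMITIVE letters at `b = 1`.**
Data AT THE REAL COUPLING (`b = 1`): the term's σ-families `A(σ)` (precision), `Γ(σ)X = G(σ)·X` (cross operator, linear),
the characteristic functions `χ_{k,Y₀}`, `χᶜ_{k,P}` with (2.22), the potentials split as `W` (Wilson part, to be multiplied
by `b²`) and `O` (older terms, `b`-free) with the joint (2.20) shape `Σ|τ(Y)|(|W| + |O|) ≤ ½a₂₀‖B‖² + w` on the per-domain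
τ-region, the real references `C ≻ 0`, `Γ₀`, and the letters of `B13Lemma3TorusPrimitivePoly.h226_torus_of_primitives_holo_polyτ`
on the OPEN σ-polydisc (entrywise σ-holomorphy of `A`, `G`; measurability; symmetry of `A(σ)`; (L17a) `K_G, K_Γ, K_{Cσ}, K₀`;
(L16a) `θ_Γ, θ_C, θ_E`) plus ONE extra letter `K_E` (entrywise decay of `C⁻¹`, `hCE`); a radius `ρ_b < 1`; primed letters
`K_G′, K_{Cσ}′, θ_Γ′, θ_C′, θ_E′, a′, w′` dominating the §2 transports; and the capstone's numeric conditions (`hθEle … hsmall`,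
`hPa`, `hvol`) in the PRIMED letters.  NOT assumed: `Re(b²A(σ)) ≻ 0` — it follows (`posDef_re_of_form`).  Conclusion: for every
`b` with `|b − 1| < ρ_b`, the term (2.14) of the family `(b²A(σ), bΓ(σ), 𝐕 = b²W + O)` obeys (2.26) in the spelling of the torus
resummation, `‖(2.14)_b‖ ≤ weight L M c Z a t · exp(a₅·|Z|)` — ONE application of `h226_torus_of_primitives_holo_polyτ` at the
transported letters; the price of the complex coupling is inside `hvol` (linear in `ρ_b`, per-cube).
[cite: Balaban1988RG2Cluster, (2.14)–(2.15) p.15, (2.16)–(2.22) p.16, (2.23)–(2.26) p.17; Balaban1987RG1, (2.10)-(2.12) p.267] -/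
theorem h226_torus_windowDilated_of_primitives (c : B13.Consts) (hκ₁ : 1 ≤ c.κ₁) (hα₆ : c.α₆ ≠ 0)
    (Z : TDom d N') (t : Finset (TDom d (L * N')) × Finset (TBond d M (L * N')))
    (hpos : ∀ Y : TDom d (L * N'), 0 < invTau c ((tsys d (L * N')).dj Y))
    (hhalf : ∀ Y : TDom d (L * N'), invTau c ((tsys d (L * N')).dj Y) ≤ 1 / 2)
    {Uσ : Set ℂ} {Uτ : TDom d (L * N') → Set ℂ} (hUσ : IsOpen Uσ) (hUτ : ∀ Y, IsOpen (Uτ Y))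
    (hUexp : closedBall (0 : ℂ) (Real.exp c.κ₁) ⊆ Uσ)
    (hUtau : ∀ Y : TDom d (L * N'), closedBall (0 : ℂ) ((invTau c ((tsys d (L * N')).dj Y))⁻¹) ⊆ Uτ Y)
    {r : ℝ} (hr : 0 < r) (hr' : r ≤ Real.exp c.κ₁ - 1)
    (hsubτ : ∀ Y, ∀ s ∈ Set.uIcc (0 : ℝ) 1, closedBall (s : ℂ) r ⊆ Uτ Y)
    -- the parameter lists of the term: σ over the blocks of Z∖Z′₀, τ over 𝐃
    (lZ : List (TPt d N')) (hlZ : lZ.Nodup ∧ lZ.toFinset = Z.1 \ tclosure L N' (Z0 M t))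
    (lD : List (TDom d (L * N'))) (hlD : lD.Nodup ∧ lD.toFinset = t.1)
    -- the (2.14)-data of the term AT THE REAL COUPLING (b = 1)
    (A : (TPt d N' → ℂ) → Matrix Λ Λ ℂ) (Γ : (TPt d N' → ℂ) → (Λ ⊕ C₀ → ℝ) → (Λ → ℂ))
    (χY₀ χcP : (Λ → ℝ) → ℝ) (hχ0 : ∀ B, 0 ≤ χY₀ B) (hχc0 : ∀ B, 0 ≤ χcP B) (Dfam : Finset (TDom d (L * N')))
    (W O : TDom d (L * N') → (Λ → ℝ) → ℂ)
    {C : Matrix Λ Λ ℝ} (hC : C.PosDef) (Γ₀ : Matrix Λ (Λ ⊕ C₀) ℝ)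
    (hAhol : ∀ i j, DifferentiableOn ℂ (fun σ => A σ i j) {σ | ∀ j, σ j ∈ Uσ})
    (hχm : Measurable χY₀) (hχcm : Measurable χcP) (hWm : ∀ Y, Measurable (W Y)) (hOm : ∀ Y, Measurable (O Y))
    (hAs : ∀ σ : TPt d N' → ℂ, (∀ j, σ j ∈ Uσ) → (A σ).IsSymm)
    -- the Γ-operator is linear with kernel G(σ), entrywise holomorphic
    (G : (TPt d N' → ℂ) → Matrix Λ (Λ ⊕ C₀) ℂ)
    (hGhol : ∀ i j, DifferentiableOn ℂ (fun σ => G σ i j) {σ | ∀ j, σ j ∈ Uσ})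
    (hlin : ∀ σ : TPt d N' → ℂ, (∀ j, σ j ∈ Uσ) → ∀ X : Λ ⊕ C₀ → ℝ, Γ σ X = G σ *ᵥ fun j => (X j : ℂ))
    -- the (2.22) shape, and the joint (2.20) shape of |W| + |O| on the open per-domain τ-region
    {γ₂ rP a₂₀ w : ℝ} (qP : (Λ → ℝ) → ℝ)
    (h222 : ∀ B, χY₀ B * χcP B ≤ Real.exp (-(γ₂ / 2 * rP ^ 2 * (t.2.card : ℕ)) + γ₂ / 2 * qP B)) (hγ₂ : 0 ≤ γ₂)
    (hqP : ∀ B, qP B ≤ B ⬝ᵥ B) (ha0 : 0 ≤ a₂₀)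
    (h220U : ∀ τ : TDom d (L * N') → ℂ, (∀ Y, τ Y ∈ Uτ Y) →
      ∀ B, ∑ Y ∈ Dfam, ‖τ Y‖ * (‖W Y B‖ + ‖O Y B‖) ≤ a₂₀ / 2 * (B ⬝ᵥ B) + w)
    -- bonds located on the torus `UT Nf`
    (locΛ : Λ → UT Nf) (locN : Λ ⊕ C₀ → UT Nf) {m : ℕ}
    (hfibΛ : ∀ x : UT Nf, (Finset.univ.filter fun i => locΛ i = x).card ≤ m)
    (hfibN : ∀ x : UT Nf, (Finset.univ.filter fun j => locN j = x).card ≤ m)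
    -- rates and the letters AT b = 1 (+ K_E)
    {kap kap' kap'' θ θE θΓ θC KG KΓ KCs K₀ KE : ℝ} (hkap'' : 0 < kap'') (h1 : kap'' < kap') (h2 : kap' < kap)
    (hθE : 0 ≤ θE) (hθΓ : 0 ≤ θΓ) (hθC : 0 ≤ θC) (hKG : 0 ≤ KG) (hKΓ : 0 ≤ KΓ) (hKCs : 0 ≤ KCs) (hK₀ : 0 ≤ K₀)
    (hKE : 0 ≤ KE)
    (hG : ∀ σ : TPt d N' → ℂ, (∀ j, σ j ∈ Uσ) →
      ∀ b j, ‖G σ b j‖ ≤ KG * Real.exp (-(kap * tdist1 Nf (locΛ b) (locN j))))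
    (hΓ₀ : ∀ b j, ‖Γ₀ b j‖ ≤ KΓ * Real.exp (-(kap * tdist1 Nf (locΛ b) (locN j))))
    (hCs : ∀ σ : TPt d N' → ℂ, (∀ j, σ j ∈ Uσ) →
      ∀ b b', ‖(A σ)⁻¹ b b'‖ ≤ KCs * Real.exp (-(kap * tdist1 Nf (locΛ b) (locΛ b'))))
    (hC216 : ∀ b b', ‖C b b'‖ ≤ K₀ * Real.exp (-(kap * tdist1 Nf (locΛ b) (locΛ b'))))
    (hCE : ∀ b b', ‖(C⁻¹.map (algebraMap ℝ ℂ)) b b'‖ ≤ KE * Real.exp (-(kap * tdist1 Nf (locΛ b) (locΛ b'))))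
    (hdΓ : ∀ σ : TPt d N' → ℂ, (∀ j, σ j ∈ Uσ) →
      ∀ b j, ‖(G σ - Γ₀.map (algebraMap ℝ ℂ)) b j‖ ≤ θΓ * Real.exp (-(kap * tdist1 Nf (locΛ b) (locN j))))
    (hdC : ∀ σ : TPt d N' → ℂ, (∀ j, σ j ∈ Uσ) →
      ∀ b b', ‖((A σ)⁻¹ - C.map (algebraMap ℝ ℂ)) b b'‖
        ≤ θC * Real.exp (-(kap * tdist1 Nf (locΛ b) (locΛ b'))))
    (hdE : ∀ σ : TPt d N' → ℂ, (∀ j, σ j ∈ Uσ) →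
      ∀ b b', ‖(A σ - C⁻¹.map (algebraMap ℝ ℂ)) b b'‖ ≤ θE * Real.exp (-(kap * tdist1 Nf (locΛ b) (locΛ b'))))
    -- the radius of the ball in `b` and the PRIMED letters dominating the §2 transports
    {ρb KG' KCs' θΓ' θC' θE' a' w' : ℝ} (hρb1 : ρb < 1)
    (hKG' : (1 + ρb) * KG ≤ KG') (hKCs' : ((1 - ρb) ^ 2)⁻¹ * KCs ≤ KCs')
    (hθΓ' : θΓ + ρb * KG ≤ θΓ') (hθC' : θC + ρb * (2 + ρb) * ((1 - ρb) ^ 2)⁻¹ * KCs ≤ θC')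
    (hθE' : θE + ρb * (2 + ρb) * (θE + KE) ≤ θE')
    (ha' : (1 + ρb) ^ 2 * a₂₀ ≤ a') (hw' : (1 + ρb) ^ 2 * w ≤ w')
    -- the capstone's numeric conditions in the primed letters
    (hθEle : θE' ≤ θ) (hθΓle : θΓ' ≤ θ)
    (hθR1le : (m * (1 + 2 / (kap - kap')) ^ ν) * (m * (1 + 2 / (kap' - kap'')) ^ ν)
      * (θΓ' * KCs' * KG' + KΓ * θC' * KG' + KΓ * K₀ * θΓ') ≤ θ)
    (hsmallKθ : K₀ * (m * (1 + 2 / kap) ^ ν) * (θ * (m * (1 + 2 / kap'') ^ ν)) < 1)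
    {cE g : ℝ} (hc0 : 0 ≤ cE) (hc : ∀ k, hC.1.eigenvalues k ≤ cE)
    (hαc : (2 * (θ * (m * (1 + 2 / kap'') ^ ν)) + (γ₂ + a')) * cE ≤ 1 / 2) (hg : 0 ≤ g)
    (hΓq : ∀ X : Λ ⊕ C₀ → ℝ, (Γ₀ *ᵥ X) ⬝ᵥ (C *ᵥ (Γ₀ *ᵥ X)) ≤ g * (X ⬝ᵥ X))
    (hsmall : (2 * (θ * (m * (1 + 2 / kap'') ^ ν)) + (γ₂ + a')) * (1 + 2 * cE * g) ≤ 1 / 2)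
    -- constant matching, p. 17, in the primed letters: the |P|-rate of the weight and «exp O(1)α₅|Z|»
    {a a₅ : ℝ} (hPa : a ≤ γ₂ * rP ^ 2)
    (hvol : 2 * (K₀ * (m * (1 + 2 / kap) ^ ν) * (θ * (m * (1 + 2 / kap'') ^ ν))
              * (1 + (1 - K₀ * (m * (1 + 2 / kap) ^ ν) * (θ * (m * (1 + 2 / kap'') ^ ν)))⁻¹) / 2)
          * (Fintype.card Λ : ℝ)
        + w' + (2 * (θ * (m * (1 + 2 / kap'') ^ ν)) + (γ₂ + a')) * cE * (Fintype.card Λ : ℝ)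
        + (2 * (θ * (m * (1 + 2 / kap'') ^ ν)) + (γ₂ + a')) * (1 + 2 * cE * g) * (Fintype.card (Λ ⊕ C₀) : ℝ)
        ≤ a₅ * ((Z.1).card : ℝ)) :
    ∀ b ∈ ball (1 : ℂ) ρb,
      ‖term214 r lZ lD (core214 (fun σ => b ^ 2 • A σ) (fun σ X => b • Γ σ X)
          (F214 t.2.card χY₀ χcP Dfam (fun Y B => b ^ 2 * W Y B + O Y B))) 0 0‖ ≤
        weight L M c Z a t * Real.exp (a₅ * ((Z.1).card : ℝ)) := by
  intro b hb
  have hρb0 : 0 ≤ ρb := rad_nonneg_of_mem_ball hb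
  have hexp : ∀ x : ℝ, 0 ≤ Real.exp x := fun x => (Real.exp_pos x).le
  have hθ : 0 ≤ θ := le_trans (le_trans (by positivity) hθE') hθEle
  have hkk : kap'' ≤ kap := (h1.trans h2).le
  have ha0' : 0 ≤ a' := le_trans (by positivity) ha'
  -- the transported letters at this `b`
  have hG' : ∀ σ : TPt d N' → ℂ, (∀ j, σ j ∈ Uσ) →
      ∀ i j, ‖(b • G σ) i j‖ ≤ KG' * Real.exp (-(kap * tdist1 Nf (locΛ i) (locN j))) := fun σ hσ i j =>
    (smul_entry_le (hG σ hσ) hb i j).trans (mul_le_mul_of_nonneg_right hKG' (hexp _))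
  have hCs' : ∀ σ : TPt d N' → ℂ, (∀ j, σ j ∈ Uσ) →
      ∀ i j, ‖(b ^ 2 • A σ)⁻¹ i j‖ ≤ KCs' * Real.exp (-(kap * tdist1 Nf (locΛ i) (locΛ j))) := fun σ hσ i j =>
    (inv_sq_smul_entry_le (hCs σ hσ) hρb1 hb i j).trans (mul_le_mul_of_nonneg_right hKCs' (hexp _))
  have hdΓ' : ∀ σ : TPt d N' → ℂ, (∀ j, σ j ∈ Uσ) →
      ∀ i j, ‖(b • G σ - Γ₀.map (algebraMap ℝ ℂ)) i j‖ ≤ θΓ' * Real.exp (-(kap * tdist1 Nf (locΛ i) (locN j))) :=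
    fun σ hσ i j => (smul_sub_entry_le (hG σ hσ) (hdΓ σ hσ) hb i j).trans (mul_le_mul_of_nonneg_right hθΓ' (hexp _))
  have hdC' : ∀ σ : TPt d N' → ℂ, (∀ j, σ j ∈ Uσ) →
      ∀ i j, ‖((b ^ 2 • A σ)⁻¹ - C.map (algebraMap ℝ ℂ)) i j‖
        ≤ θC' * Real.exp (-(kap * tdist1 Nf (locΛ i) (locΛ j))) := fun σ hσ i j =>
    (inv_sq_smul_sub_entry_le (hCs σ hσ) (hdC σ hσ) hρb1 hb i j).trans (mul_le_mul_of_nonneg_right hθC' (hexp _))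
  have hdE' : ∀ σ : TPt d N' → ℂ, (∀ j, σ j ∈ Uσ) →
      ∀ i j, ‖(b ^ 2 • A σ - C⁻¹.map (algebraMap ℝ ℂ)) i j‖
        ≤ θE' * Real.exp (-(kap * tdist1 Nf (locΛ i) (locΛ j))) := fun σ hσ i j =>
    (sq_smul_sub_entry_le hCE (hdE σ hσ) hb i j).trans (mul_le_mul_of_nonneg_right hθE' (hexp _))
  -- `Re(b²A(σ)) ≻ 0` on the open σ-polydisc, from the transported E-letter (rate dropped to κ″, constant θ)
  have hA' : ∀ σ : TPt d N' → ℂ, (∀ j, σ j ∈ Uσ) → ((b ^ 2 • A σ).map Complex.re).PosDef := by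
    intro σ hσ
    have h216E : ∀ i j, ‖(b ^ 2 • A σ - C⁻¹.map (algebraMap ℝ ℂ)) i j‖
        ≤ θ * Real.exp (-(kap'' * tdist1 Nf (locΛ i) (locΛ j))) := fun i j =>
      (entry_bound_mono_rate (weightHyp_tdist1 (N := Nf)) (le_trans (by positivity) hθE') hkk locΛ locΛ (hdE' σ hσ)
        i j).trans (mul_le_mul_of_nonneg_right hθEle (hexp _))
    refine posDef_re_of_form ((hAs σ hσ).smul _) hC hc
      (hR2_of_entrywise (weightHyp_tdist1 (N := Nf)) tdist1_symm kc_tdist1 hθ hkap'' locΛ hfibΛ h216E) ?_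
    exact theta_mul_lt_one hγ₂ ha0' hc0 hαc
  -- ONE application of the torus capstone at the transported letters
  exact h226_torus_of_primitives_holo_polyτ c hκ₁ hα₆ Z t hpos hhalf hUσ hUτ hUexp hUtau hr hr' hsubτ lZ hlZ lD hlD
    (fun σ => b ^ 2 • A σ) (fun σ X => b • Γ σ X) χY₀ χcP hχ0 hχc0 Dfam (fun Y B => b ^ 2 * W Y B + O Y B) hC Γ₀
    (fun i j => by
      simpa only [Matrix.smul_apply, smul_eq_mul] using (hAhol i j).const_mul (b ^ 2))
    hχm hχcm (fun Y => ((hWm Y).const_mul _).add (hOm Y)) (fun σ hσ => (hAs σ hσ).smul _) hA' (fun σ => b • G σ)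
    (fun i j => by
      simpa only [Matrix.smul_apply, smul_eq_mul] using (hGhol i j).const_mul b)
    (fun σ hσ X => by rw [hlin σ hσ X, Matrix.smul_mulVec]) qP h222 hγ₂ hqP ha0'
    (fun τ hτ B => (h220_dilate Dfam τ (h220U τ hτ) hb B).trans
      (add_le_add (mul_le_mul_of_nonneg_right (by linarith)
        (Finset.sum_nonneg fun i _ => mul_self_nonneg (B i))) hw'))
    locΛ locN hfibΛ hfibN hkap'' h1 h2 (le_trans (by positivity) hθE') (le_trans (by positivity) hθΓ')
    (le_trans (by positivity) hθC') (le_trans (by positivity) hKG') hKΓ (le_trans (by positivity) hKCs') hK₀ hθEle hθΓle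
    hθR1le hG' hΓ₀ hCs' hC216 hdΓ' hdC' hdE' hsmallKθ hc0 hc hαc hg hΓq hsmall hPa hvol

open Classical in
/-- **THE WINDOW-DILATED TERM IS HOLOMORPHIC IN `b` ON THE BALL, for one term of the torus model, from the PRIMITIVE letters
at `b = 1`** — same data and letters as `h226_torus_windowDilated_of_primitives` (the (2.20) shape here on the open per-domain
τ-region, as there), the family being POLYNOMIAL in `b` (`b²A(σ)`, `bG(σ)`, `b²W + O`): ONE application of
`B13Term214ParamHolo.differentiableOn_term214_torus_param_of_primitives_holo_polyτ` with the parameter space `ℂ`, `W = ball 1 ρ_b`,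
the transported letters uniform on the ball, and `Re(b²A(σ)) ≻ 0` derived.  Composed with `u ↦ s₀/u`
(`differentiableOn_closedBall_of_ball`) this is the holomorphy half of node N22's (S-last-T′)∕(S-226-T′) on the disc
`‖u − s₀‖ ≤ c_A s₀` whenever `c_A/(1 − c_A) < ρ_b`. [cite: Balaban1988RG2Cluster, (2.14)–(2.15) p.15, (2.16)–(2.22) p.16, (2.23)–(2.25) p.17; Balaban1987RG1, §1 p.263, (2.10)-(2.12) p.267] -/
theorem differentiableOn_term214_torus_windowDilated_of_primitives (c : B13.Consts)
    {Uσ : Set ℂ} {Uτ : TDom d (L * N') → Set ℂ} (hUσ : IsOpen Uσ) (hUτ : ∀ Y, IsOpen (Uτ Y))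
    (hUexp : closedBall (0 : ℂ) (Real.exp c.κ₁) ⊆ Uσ)
    {r : ℝ} (hr : 0 < r) (hr' : r ≤ Real.exp c.κ₁ - 1)
    (hsubτ : ∀ Y, ∀ s ∈ Set.uIcc (0 : ℝ) 1, closedBall (s : ℂ) r ⊆ Uτ Y)
    {lZ : List (TPt d N')} (hlZ : lZ.Nodup) {lD : List (TDom d (L * N'))} (hlD : lD.Nodup)
    (A : (TPt d N' → ℂ) → Matrix Λ Λ ℂ) (Γ : (TPt d N' → ℂ) → (Λ ⊕ C₀ → ℝ) → (Λ → ℂ))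
    (cardP : ℕ) (χY₀ χcP : (Λ → ℝ) → ℝ) (hχ0 : ∀ B, 0 ≤ χY₀ B) (hχc0 : ∀ B, 0 ≤ χcP B)
    (Dfam : Finset (TDom d (L * N'))) (W O : TDom d (L * N') → (Λ → ℝ) → ℂ)
    {C : Matrix Λ Λ ℝ} (hC : C.PosDef) (Γ₀ : Matrix Λ (Λ ⊕ C₀) ℝ)
    (hAhol : ∀ i j, DifferentiableOn ℂ (fun σ => A σ i j) {σ | ∀ j, σ j ∈ Uσ})
    (hχm : Measurable χY₀) (hχcm : Measurable χcP) (hWm : ∀ Y, Measurable (W Y)) (hOm : ∀ Y, Measurable (O Y))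
    (hAs : ∀ σ : TPt d N' → ℂ, (∀ j, σ j ∈ Uσ) → (A σ).IsSymm)
    (G : (TPt d N' → ℂ) → Matrix Λ (Λ ⊕ C₀) ℂ)
    (hGhol : ∀ i j, DifferentiableOn ℂ (fun σ => G σ i j) {σ | ∀ j, σ j ∈ Uσ})
    (hlin : ∀ σ : TPt d N' → ℂ, (∀ j, σ j ∈ Uσ) → ∀ X : Λ ⊕ C₀ → ℝ, Γ σ X = G σ *ᵥ fun j => (X j : ℂ))
    {γ₂ rP a₂₀ w : ℝ} (qP : (Λ → ℝ) → ℝ)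
    (h222 : ∀ B, χY₀ B * χcP B ≤ Real.exp (-(γ₂ / 2 * rP ^ 2 * cardP) + γ₂ / 2 * qP B)) (hγ₂ : 0 ≤ γ₂)
    (hqP : ∀ B, qP B ≤ B ⬝ᵥ B) (ha0 : 0 ≤ a₂₀)
    (h220U : ∀ τ : TDom d (L * N') → ℂ, (∀ Y, τ Y ∈ Uτ Y) →
      ∀ B, ∑ Y ∈ Dfam, ‖τ Y‖ * (‖W Y B‖ + ‖O Y B‖) ≤ a₂₀ / 2 * (B ⬝ᵥ B) + w)
    (locΛ : Λ → UT Nf) (locN : Λ ⊕ C₀ → UT Nf) {m : ℕ}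
    (hfibΛ : ∀ x : UT Nf, (Finset.univ.filter fun i => locΛ i = x).card ≤ m)
    (hfibN : ∀ x : UT Nf, (Finset.univ.filter fun j => locN j = x).card ≤ m)
    {kap kap' kap'' θ θE θΓ θC KG KΓ KCs K₀ KE : ℝ} (hkap'' : 0 < kap'') (h1 : kap'' < kap') (h2 : kap' < kap)
    (hθE : 0 ≤ θE) (hθΓ : 0 ≤ θΓ) (hθC : 0 ≤ θC) (hKG : 0 ≤ KG) (hKΓ : 0 ≤ KΓ) (hKCs : 0 ≤ KCs) (hK₀ : 0 ≤ K₀)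
    (hKE : 0 ≤ KE)
    (hG : ∀ σ : TPt d N' → ℂ, (∀ j, σ j ∈ Uσ) →
      ∀ b j, ‖G σ b j‖ ≤ KG * Real.exp (-(kap * tdist1 Nf (locΛ b) (locN j))))
    (hΓ₀ : ∀ b j, ‖Γ₀ b j‖ ≤ KΓ * Real.exp (-(kap * tdist1 Nf (locΛ b) (locN j))))
    (hCs : ∀ σ : TPt d N' → ℂ, (∀ j, σ j ∈ Uσ) →
      ∀ b b', ‖(A σ)⁻¹ b b'‖ ≤ KCs * Real.exp (-(kap * tdist1 Nf (locΛ b) (locΛ b'))))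
    (hC216 : ∀ b b', ‖C b b'‖ ≤ K₀ * Real.exp (-(kap * tdist1 Nf (locΛ b) (locΛ b'))))
    (hCE : ∀ b b', ‖(C⁻¹.map (algebraMap ℝ ℂ)) b b'‖ ≤ KE * Real.exp (-(kap * tdist1 Nf (locΛ b) (locΛ b'))))
    (hdΓ : ∀ σ : TPt d N' → ℂ, (∀ j, σ j ∈ Uσ) →
      ∀ b j, ‖(G σ - Γ₀.map (algebraMap ℝ ℂ)) b j‖ ≤ θΓ * Real.exp (-(kap * tdist1 Nf (locΛ b) (locN j))))
    (hdC : ∀ σ : TPt d N' → ℂ, (∀ j, σ j ∈ Uσ) →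
      ∀ b b', ‖((A σ)⁻¹ - C.map (algebraMap ℝ ℂ)) b b'‖
        ≤ θC * Real.exp (-(kap * tdist1 Nf (locΛ b) (locΛ b'))))
    (hdE : ∀ σ : TPt d N' → ℂ, (∀ j, σ j ∈ Uσ) →
      ∀ b b', ‖(A σ - C⁻¹.map (algebraMap ℝ ℂ)) b b'‖ ≤ θE * Real.exp (-(kap * tdist1 Nf (locΛ b) (locΛ b'))))
    {ρb KG' KCs' θΓ' θC' θE' a' w' : ℝ} (hρb1 : ρb < 1)
    (hKG' : (1 + ρb) * KG ≤ KG') (hKCs' : ((1 - ρb) ^ 2)⁻¹ * KCs ≤ KCs')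
    (hθΓ' : θΓ + ρb * KG ≤ θΓ') (hθC' : θC + ρb * (2 + ρb) * ((1 - ρb) ^ 2)⁻¹ * KCs ≤ θC')
    (hθE' : θE + ρb * (2 + ρb) * (θE + KE) ≤ θE')
    (ha' : (1 + ρb) ^ 2 * a₂₀ ≤ a') (hw' : (1 + ρb) ^ 2 * w ≤ w')
    (hθEle : θE' ≤ θ) (hθΓle : θΓ' ≤ θ)
    (hθR1le : (m * (1 + 2 / (kap - kap')) ^ ν) * (m * (1 + 2 / (kap' - kap'')) ^ ν)
      * (θΓ' * KCs' * KG' + KΓ * θC' * KG' + KΓ * K₀ * θΓ') ≤ θ)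
    (hsmallKθ : K₀ * (m * (1 + 2 / kap) ^ ν) * (θ * (m * (1 + 2 / kap'') ^ ν)) < 1)
    {cE g : ℝ} (hc0 : 0 ≤ cE) (hc : ∀ k, hC.1.eigenvalues k ≤ cE)
    (hαc : (2 * (θ * (m * (1 + 2 / kap'') ^ ν)) + (γ₂ + a')) * cE ≤ 1 / 2)
    (hΓq : ∀ X : Λ ⊕ C₀ → ℝ, (Γ₀ *ᵥ X) ⬝ᵥ (C *ᵥ (Γ₀ *ᵥ X)) ≤ g * (X ⬝ᵥ X))
    (hsmall : (2 * (θ * (m * (1 + 2 / kap'') ^ ν)) + (γ₂ + a')) * (1 + 2 * cE * g) ≤ 1 / 2) :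
    DifferentiableOn ℂ (fun b : ℂ => term214 r lZ lD (core214 (fun σ => b ^ 2 • A σ) (fun σ X => b • Γ σ X)
      (F214 cardP χY₀ χcP Dfam (fun Y B => b ^ 2 * W Y B + O Y B))) 0 0) (ball (1 : ℂ) ρb) := by
  -- an empty ball carries nothing; otherwise `0 < ρ_b`
  rcases le_or_gt ρb 0 with hρb0 | hρb0
  · rw [Metric.ball_eq_empty.2 hρb0]
    exact differentiableOn_empty
  have hexp : ∀ x : ℝ, 0 ≤ Real.exp x := fun x => (Real.exp_pos x).le
  have hθ : 0 ≤ θ := le_trans (le_trans (by positivity) hθE') hθEle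
  have hkk : kap'' ≤ kap := (h1.trans h2).le
  have ha0' : 0 ≤ a' := le_trans (by positivity) ha'
  -- the transported E-letter and the derived positivity, per `b` of the ball
  have hdE' : ∀ b ∈ ball (1 : ℂ) ρb, ∀ σ : TPt d N' → ℂ, (∀ j, σ j ∈ Uσ) →
      ∀ i j, ‖(b ^ 2 • A σ - C⁻¹.map (algebraMap ℝ ℂ)) i j‖
        ≤ θE' * Real.exp (-(kap * tdist1 Nf (locΛ i) (locΛ j))) := fun b hb σ hσ i j =>
    (sq_smul_sub_entry_le hCE (hdE σ hσ) hb i j).trans (mul_le_mul_of_nonneg_right hθE' (hexp _))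
  have hA' : ∀ b ∈ ball (1 : ℂ) ρb, ∀ σ : TPt d N' → ℂ, (∀ j, σ j ∈ Uσ) →
      ((b ^ 2 • A σ).map Complex.re).PosDef := by
    intro b hb σ hσ
    have h216E : ∀ i j, ‖(b ^ 2 • A σ - C⁻¹.map (algebraMap ℝ ℂ)) i j‖
        ≤ θ * Real.exp (-(kap'' * tdist1 Nf (locΛ i) (locΛ j))) := fun i j =>
      (entry_bound_mono_rate (weightHyp_tdist1 (N := Nf)) (le_trans (by positivity) hθE') hkk locΛ locΛ
        (hdE' b hb σ hσ) i j).trans (mul_le_mul_of_nonneg_right hθEle (hexp _))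
    refine posDef_re_of_form ((hAs σ hσ).smul _) hC hc
      (hR2_of_entrywise (weightHyp_tdist1 (N := Nf)) tdist1_symm kc_tdist1 hθ hkap'' locΛ hfibΛ h216E) ?_
    exact theta_mul_lt_one hγ₂ ha0' hc0 hαc
  -- ONE application of the parametric engine (module 36 §7), the family polynomial in `b`
  exact differentiableOn_term214_torus_param_of_primitives_holo_polyτ (P := ℂ) (W := ball (1 : ℂ) ρb) c isOpen_ball
    hUσ hUτ hUexp hr hr' hsubτ hlZ hlD (fun b σ => b ^ 2 • A σ) (fun b σ X => b • Γ σ X) cardP χY₀ χcP hχ0 hχc0 Dfam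
    (fun b Y B => b ^ 2 * W Y B + O Y B) hC Γ₀
    (fun b _ i j => by
      simpa only [Matrix.smul_apply, smul_eq_mul] using (hAhol i j).const_mul (b ^ 2))
    (fun σ _ i j => by
      simp only [Matrix.smul_apply, smul_eq_mul]
      exact (differentiableOn_id.pow 2).mul (differentiableOn_const _))
    hχm hχcm (fun b _ Y => ((hWm Y).const_mul _).add (hOm Y))
    (fun Y B => ((differentiableOn_id.pow 2).mul (differentiableOn_const _)).add (differentiableOn_const _))
    (fun b _ σ hσ => (hAs σ hσ).smul _) hA' (fun b σ => b • G σ)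
    (fun b _ i j => by
      simpa only [Matrix.smul_apply, smul_eq_mul] using (hGhol i j).const_mul b)
    (fun σ _ i j => by
      simp only [Matrix.smul_apply, smul_eq_mul]
      exact differentiableOn_id.mul (differentiableOn_const _))
    (fun b _ σ hσ X => by rw [hlin σ hσ X, Matrix.smul_mulVec]) qP h222 hγ₂ hqP ha0'
    (fun b hb τ hτ B => (h220_dilate Dfam τ (h220U τ hτ) hb B).trans
      (add_le_add (mul_le_mul_of_nonneg_right (by linarith)
        (Finset.sum_nonneg fun i _ => mul_self_nonneg (B i))) hw'))
    locΛ locN hfibΛ hfibN hkap'' h1 h2 (le_trans (by positivity) hθE') (le_trans (by positivity) hθΓ')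
    (le_trans (by positivity) hθC') (le_trans (by positivity) hKG') hKΓ (le_trans (by positivity) hKCs') hK₀ hθEle hθΓle
    hθR1le
    (fun b hb σ hσ i j => (smul_entry_le (hG σ hσ) hb i j).trans (mul_le_mul_of_nonneg_right hKG' (hexp _))) hΓ₀
    (fun b hb σ hσ i j => (inv_sq_smul_entry_le (hCs σ hσ) hρb1 hb i j).trans
      (mul_le_mul_of_nonneg_right hKCs' (hexp _))) hC216
    (fun b hb σ hσ i j => (smul_sub_entry_le (hG σ hσ) (hdΓ σ hσ) hb i j).trans
      (mul_le_mul_of_nonneg_right hθΓ' (hexp _)))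
    (fun b hb σ hσ i j => (inv_sq_smul_sub_entry_le (hCs σ hσ) (hdC σ hσ) hρb1 hb i j).trans
      (mul_le_mul_of_nonneg_right hθC' (hexp _)))
    hdE' hsmallKθ hc0 hc hαc hΓq hsmall

end Torus

/-! ## §5 (v1.1, append-only). The history direction along the family: holomorphy in an external parameter entering the
older terms only, at a FIXED member `b` -/

section History

variable {d L N' : ℕ} [NeZero L] [NeZero N']
variable {ν : ℕ} {Nf : Fin ν → ℕ} [∀ i, NeZero (Nf i)]
variable {C₀ : Type} [Fintype C₀] [DecidableEq C₀]
variable {P : Type*} [NormedAddCommGroup P] [NormedSpace ℂ P] {Wp : Set P}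

open Classical in
/-- **THE WINDOW-DILATED TERM AT A FIXED MEMBER `b` IS HOLOMORPHIC IN ANY EXTERNAL PARAMETER ENTERING THE OLDER TERMS ONLY** —
the history direction of node N22's (S-226-T′) at a fixed complex last coupling ([II] p. 16: the older terms enter the last
exponential of (2.14) linearly, the (2.26) majorant is blind to them): same data and letters at `b = 1` as
`h226_torus_windowDilated_of_primitives`, the older-terms part `O_p` now parametrised by `p` of an open set `Wp` of a complex normed
space (`O_p(Y,·)` measurable, `p ↦ O_p(Y, B)` holomorphic on `Wp`, the joint (2.20) shape of `|W| + |O_p|` uniform in `p`), and ONE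
member `b` of the ball; conclusion: `p ↦ (2.14)_b` with potentials `b²W + O_p` is complex differentiable on `Wp` — ONE application
of `B13Term214ParamHolo.differentiableOn_term214_torus_of_primitives_holo_polyτ` (§4: parameter in the potentials only) at the
kernels `b²A(σ)`, `bG(σ)` with the transported letters and `Re(b²A(σ)) ≻ 0` derived.  (The (2.26) bound along the history is
`h226_torus_windowDilated_of_primitives` at `O := O_p`, pointwise in `p`.) [cite: Balaban1988RG2Cluster, (2.14)–(2.15) p.15, (2.16)–(2.22) p.16, (2.23)–(2.25) p.17, (1.41) p.11; Balaban1987RG1, (2.10)-(2.12) p.267] -/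
theorem differentiableOn_term214_torus_windowDilated_history_of_primitives (c : B13.Consts) (hWp : IsOpen Wp)
    {Uσ : Set ℂ} {Uτ : TDom d (L * N') → Set ℂ} (hUσ : IsOpen Uσ) (hUτ : ∀ Y, IsOpen (Uτ Y))
    (hUexp : closedBall (0 : ℂ) (Real.exp c.κ₁) ⊆ Uσ)
    {r : ℝ} (hr : 0 < r) (hr' : r ≤ Real.exp c.κ₁ - 1)
    (hsubτ : ∀ Y, ∀ s ∈ Set.uIcc (0 : ℝ) 1, closedBall (s : ℂ) r ⊆ Uτ Y)
    {lZ : List (TPt d N')} (hlZ : lZ.Nodup) {lD : List (TDom d (L * N'))} (hlD : lD.Nodup)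
    (A : (TPt d N' → ℂ) → Matrix Λ Λ ℂ) (Γ : (TPt d N' → ℂ) → (Λ ⊕ C₀ → ℝ) → (Λ → ℂ))
    (cardP : ℕ) (χY₀ χcP : (Λ → ℝ) → ℝ) (hχ0 : ∀ B, 0 ≤ χY₀ B) (hχc0 : ∀ B, 0 ≤ χcP B)
    (Dfam : Finset (TDom d (L * N'))) (W : TDom d (L * N') → (Λ → ℝ) → ℂ) (O : P → TDom d (L * N') → (Λ → ℝ) → ℂ)
    {C : Matrix Λ Λ ℝ} (hC : C.PosDef) (Γ₀ : Matrix Λ (Λ ⊕ C₀) ℝ)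
    (hAhol : ∀ i j, DifferentiableOn ℂ (fun σ => A σ i j) {σ | ∀ j, σ j ∈ Uσ})
    (hχm : Measurable χY₀) (hχcm : Measurable χcP) (hWm : ∀ Y, Measurable (W Y))
    (hOm : ∀ p ∈ Wp, ∀ Y, Measurable (O p Y)) (hOd : ∀ Y B, DifferentiableOn ℂ (fun p => O p Y B) Wp)
    (hAs : ∀ σ : TPt d N' → ℂ, (∀ j, σ j ∈ Uσ) → (A σ).IsSymm)
    (G : (TPt d N' → ℂ) → Matrix Λ (Λ ⊕ C₀) ℂ)
    (hGhol : ∀ i j, DifferentiableOn ℂ (fun σ => G σ i j) {σ | ∀ j, σ j ∈ Uσ})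
    (hlin : ∀ σ : TPt d N' → ℂ, (∀ j, σ j ∈ Uσ) → ∀ X : Λ ⊕ C₀ → ℝ, Γ σ X = G σ *ᵥ fun j => (X j : ℂ))
    {γ₂ rP a₂₀ w : ℝ} (qP : (Λ → ℝ) → ℝ)
    (h222 : ∀ B, χY₀ B * χcP B ≤ Real.exp (-(γ₂ / 2 * rP ^ 2 * cardP) + γ₂ / 2 * qP B)) (hγ₂ : 0 ≤ γ₂)
    (hqP : ∀ B, qP B ≤ B ⬝ᵥ B) (ha0 : 0 ≤ a₂₀)
    (h220U : ∀ p ∈ Wp, ∀ τ : TDom d (L * N') → ℂ, (∀ Y, τ Y ∈ Uτ Y) →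
      ∀ B, ∑ Y ∈ Dfam, ‖τ Y‖ * (‖W Y B‖ + ‖O p Y B‖) ≤ a₂₀ / 2 * (B ⬝ᵥ B) + w)
    (locΛ : Λ → UT Nf) (locN : Λ ⊕ C₀ → UT Nf) {m : ℕ}
    (hfibΛ : ∀ x : UT Nf, (Finset.univ.filter fun i => locΛ i = x).card ≤ m)
    (hfibN : ∀ x : UT Nf, (Finset.univ.filter fun j => locN j = x).card ≤ m)
    {kap kap' kap'' θ θE θΓ θC KG KΓ KCs K₀ KE : ℝ} (hkap'' : 0 < kap'') (h1 : kap'' < kap') (h2 : kap' < kap)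
    (hθE : 0 ≤ θE) (hθΓ : 0 ≤ θΓ) (hθC : 0 ≤ θC) (hKG : 0 ≤ KG) (hKΓ : 0 ≤ KΓ) (hKCs : 0 ≤ KCs) (hK₀ : 0 ≤ K₀)
    (hKE : 0 ≤ KE)
    (hG : ∀ σ : TPt d N' → ℂ, (∀ j, σ j ∈ Uσ) →
      ∀ b j, ‖G σ b j‖ ≤ KG * Real.exp (-(kap * tdist1 Nf (locΛ b) (locN j))))
    (hΓ₀ : ∀ b j, ‖Γ₀ b j‖ ≤ KΓ * Real.exp (-(kap * tdist1 Nf (locΛ b) (locN j))))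
    (hCs : ∀ σ : TPt d N' → ℂ, (∀ j, σ j ∈ Uσ) →
      ∀ b b', ‖(A σ)⁻¹ b b'‖ ≤ KCs * Real.exp (-(kap * tdist1 Nf (locΛ b) (locΛ b'))))
    (hC216 : ∀ b b', ‖C b b'‖ ≤ K₀ * Real.exp (-(kap * tdist1 Nf (locΛ b) (locΛ b'))))
    (hCE : ∀ b b', ‖(C⁻¹.map (algebraMap ℝ ℂ)) b b'‖ ≤ KE * Real.exp (-(kap * tdist1 Nf (locΛ b) (locΛ b'))))
    (hdΓ : ∀ σ : TPt d N' → ℂ, (∀ j, σ j ∈ Uσ) →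
      ∀ b j, ‖(G σ - Γ₀.map (algebraMap ℝ ℂ)) b j‖ ≤ θΓ * Real.exp (-(kap * tdist1 Nf (locΛ b) (locN j))))
    (hdC : ∀ σ : TPt d N' → ℂ, (∀ j, σ j ∈ Uσ) →
      ∀ b b', ‖((A σ)⁻¹ - C.map (algebraMap ℝ ℂ)) b b'‖
        ≤ θC * Real.exp (-(kap * tdist1 Nf (locΛ b) (locΛ b'))))
    (hdE : ∀ σ : TPt d N' → ℂ, (∀ j, σ j ∈ Uσ) →
      ∀ b b', ‖(A σ - C⁻¹.map (algebraMap ℝ ℂ)) b b'‖ ≤ θE * Real.exp (-(kap * tdist1 Nf (locΛ b) (locΛ b'))))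
    {ρb KG' KCs' θΓ' θC' θE' a' w' : ℝ} (hρb1 : ρb < 1)
    (hKG' : (1 + ρb) * KG ≤ KG') (hKCs' : ((1 - ρb) ^ 2)⁻¹ * KCs ≤ KCs')
    (hθΓ' : θΓ + ρb * KG ≤ θΓ') (hθC' : θC + ρb * (2 + ρb) * ((1 - ρb) ^ 2)⁻¹ * KCs ≤ θC')
    (hθE' : θE + ρb * (2 + ρb) * (θE + KE) ≤ θE')
    (ha' : (1 + ρb) ^ 2 * a₂₀ ≤ a') (hw' : (1 + ρb) ^ 2 * w ≤ w')
    (hθEle : θE' ≤ θ) (hθΓle : θΓ' ≤ θ)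
    (hθR1le : (m * (1 + 2 / (kap - kap')) ^ ν) * (m * (1 + 2 / (kap' - kap'')) ^ ν)
      * (θΓ' * KCs' * KG' + KΓ * θC' * KG' + KΓ * K₀ * θΓ') ≤ θ)
    (hsmallKθ : K₀ * (m * (1 + 2 / kap) ^ ν) * (θ * (m * (1 + 2 / kap'') ^ ν)) < 1)
    {cE g : ℝ} (hc0 : 0 ≤ cE) (hc : ∀ k, hC.1.eigenvalues k ≤ cE)
    (hαc : (2 * (θ * (m * (1 + 2 / kap'') ^ ν)) + (γ₂ + a')) * cE ≤ 1 / 2)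
    (hΓq : ∀ X : Λ ⊕ C₀ → ℝ, (Γ₀ *ᵥ X) ⬝ᵥ (C *ᵥ (Γ₀ *ᵥ X)) ≤ g * (X ⬝ᵥ X))
    (hsmall : (2 * (θ * (m * (1 + 2 / kap'') ^ ν)) + (γ₂ + a')) * (1 + 2 * cE * g) ≤ 1 / 2)
    {b : ℂ} (hb : b ∈ ball (1 : ℂ) ρb) :
    DifferentiableOn ℂ (fun p : P => term214 r lZ lD (core214 (fun σ => b ^ 2 • A σ) (fun σ X => b • Γ σ X)
      (F214 cardP χY₀ χcP Dfam (fun Y B => b ^ 2 * W Y B + O p Y B))) 0 0) Wp := by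
  have hρb0 : 0 ≤ ρb := rad_nonneg_of_mem_ball hb
  have hexp : ∀ x : ℝ, 0 ≤ Real.exp x := fun x => (Real.exp_pos x).le
  have hθ : 0 ≤ θ := le_trans (le_trans (by positivity) hθE') hθEle
  have hkk : kap'' ≤ kap := (h1.trans h2).le
  have ha0' : 0 ≤ a' := le_trans (by positivity) ha'
  -- the transported E-letter and the derived positivity at this `b`
  have hdE' : ∀ σ : TPt d N' → ℂ, (∀ j, σ j ∈ Uσ) →
      ∀ i j, ‖(b ^ 2 • A σ - C⁻¹.map (algebraMap ℝ ℂ)) i j‖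
        ≤ θE' * Real.exp (-(kap * tdist1 Nf (locΛ i) (locΛ j))) := fun σ hσ i j =>
    (sq_smul_sub_entry_le hCE (hdE σ hσ) hb i j).trans (mul_le_mul_of_nonneg_right hθE' (hexp _))
  have hA' : ∀ σ : TPt d N' → ℂ, (∀ j, σ j ∈ Uσ) → ((b ^ 2 • A σ).map Complex.re).PosDef := by
    intro σ hσ
    have h216E : ∀ i j, ‖(b ^ 2 • A σ - C⁻¹.map (algebraMap ℝ ℂ)) i j‖
        ≤ θ * Real.exp (-(kap'' * tdist1 Nf (locΛ i) (locΛ j))) := fun i j =>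
      (entry_bound_mono_rate (weightHyp_tdist1 (N := Nf)) (le_trans (by positivity) hθE') hkk locΛ locΛ (hdE' σ hσ)
        i j).trans (mul_le_mul_of_nonneg_right hθEle (hexp _))
    refine posDef_re_of_form ((hAs σ hσ).smul _) hC hc
      (hR2_of_entrywise (weightHyp_tdist1 (N := Nf)) tdist1_symm kc_tdist1 hθ hkap'' locΛ hfibΛ h216E) ?_
    exact theta_mul_lt_one hγ₂ ha0' hc0 hαc
  -- ONE application of module 36 §4 (parameter in the potentials only) at the dilated kernels
  exact B13Term214ParamHolo.differentiableOn_term214_torus_of_primitives_holo_polyτ c hWp hUσ hUτ hUexp hr hr' hsubτ hlZ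
    hlD (fun σ => b ^ 2 • A σ) (fun σ X => b • Γ σ X) cardP χY₀ χcP hχ0 hχc0 Dfam (fun p Y B => b ^ 2 * W Y B + O p Y B)
    hC Γ₀
    (fun i j => by
      simpa only [Matrix.smul_apply, smul_eq_mul] using (hAhol i j).const_mul (b ^ 2))
    hχm hχcm (fun p hp Y => ((hWm Y).const_mul _).add (hOm p hp Y))
    (fun Y B => (differentiableOn_const _).add (hOd Y B))
    (fun σ hσ => (hAs σ hσ).smul _) hA' (fun σ => b • G σ)
    (fun i j => by
      simpa only [Matrix.smul_apply, smul_eq_mul] using (hGhol i j).const_mul b)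
    (fun σ hσ X => by rw [hlin σ hσ X, Matrix.smul_mulVec]) qP h222 hγ₂ hqP ha0'
    (fun p hp τ hτ B => (h220_dilate Dfam τ (h220U p hp τ hτ) hb B).trans
      (add_le_add (mul_le_mul_of_nonneg_right (by linarith)
        (Finset.sum_nonneg fun i _ => mul_self_nonneg (B i))) hw'))
    locΛ locN hfibΛ hfibN hkap'' h1 h2 (le_trans (by positivity) hθE') (le_trans (by positivity) hθΓ')
    (le_trans (by positivity) hθC') (le_trans (by positivity) hKG') hKΓ (le_trans (by positivity) hKCs') hK₀ hθEle hθΓle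
    hθR1le
    (fun σ hσ i j => (smul_entry_le (hG σ hσ) hb i j).trans (mul_le_mul_of_nonneg_right hKG' (hexp _))) hΓ₀
    (fun σ hσ i j => (inv_sq_smul_entry_le (hCs σ hσ) hρb1 hb i j).trans (mul_le_mul_of_nonneg_right hKCs' (hexp _)))
    hC216
    (fun σ hσ i j => (smul_sub_entry_le (hG σ hσ) (hdΓ σ hσ) hb i j).trans (mul_le_mul_of_nonneg_right hθΓ' (hexp _)))
    (fun σ hσ i j => (inv_sq_smul_sub_entry_le (hCs σ hσ) (hdC σ hσ) hρb1 hb i j).trans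
      (mul_le_mul_of_nonneg_right hθC' (hexp _)))
    hdE' hsmallKθ hc0 hc hαc hΓq hsmall

end History

/-! ## §6 (v1.1, append-only). Changing the base point: two window points see the same complex coupling through a REAL
ratio -/

section BasePoint

variable {C₀ : Type} [Fintype C₀] [DecidableEq C₀]

omit [Fintype Λ] [DecidableEq Λ] in
/-- **The printed last line at two base points.**  If the characteristic functions, the older terms and the Wilson part at
the base point `s₁` are those at `s₀` read in the field dilated by the REAL ratio `r = s₁/s₀` (`χ₁(B) = χ₀(rB)`,
`O₁(Y,B) = O₀(Y,rB)`, `(rb)²W₁(Y,B) = b²W₀(Y,rB)` — the dilation covariance of [I] (2.9)–(2.12) read at two couplings), then the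
last line of (2.14) of the `s₁`-family at parameter `rb` is the last line of the `s₀`-family at parameter `b`, at the dilated
field. [cite: Balaban1988RG2Cluster, (2.14) p.15; Balaban1987RG1, (2.9)-(2.12) pp.266-267] -/
theorem F214_basePoint {D : Type*} (cardP : ℕ) {χ₀ χc₀ χ₁ χc₁ : (Λ → ℝ) → ℝ} (Dfam : Finset D)
    {W₀ O₀ W₁ O₁ : D → (Λ → ℝ) → ℂ} {r : ℝ} (b : ℂ) (τ : D → ℂ)
    (hχ : ∀ B, χ₁ B = χ₀ (r • B)) (hχc : ∀ B, χc₁ B = χc₀ (r • B))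
    (hW : ∀ Y B, ((r : ℂ) * b) ^ 2 * W₁ Y B = b ^ 2 * W₀ Y (r • B)) (hO : ∀ Y B, O₁ Y B = O₀ Y (r • B)) (B : Λ → ℝ) :
    F214 cardP χ₁ χc₁ Dfam (fun Y B => ((r : ℂ) * b) ^ 2 * W₁ Y B + O₁ Y B) τ B
      = F214 cardP χ₀ χc₀ Dfam (fun Y B => b ^ 2 * W₀ Y B + O₀ Y B) τ (r • B) := by
  simp only [F214, hχ, hχc, hW, hO]

/-- **BASE-POINT INDEPENDENCE OF THE CONTINUED FAMILY** (the junction node N22's consumer asked for: «`TFc` is ONE function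
of the coupling»).  Two window points `s₀`, `s₁` see the same complex coupling `u` through `b₀ = s₀/u` and `b₁ = s₁/u = r·b₀`
with the REAL ratio `r = s₁/s₀ > 0` — the complex number `u` cancels.  If the producer's last-line data at the two base points
are related by the dilation covariance of `F214_basePoint`, then the `s₁`-family at `rb` IS the `s₀`-family at `b`, for EVERY
complex `b` (`term214_dilate_family` + `F214_basePoint`; no identity theorem, no complex ratio).  Consequently the member at ANY
fixed base point serves every coupling disc `‖u − t‖ ≤ c_A t`, `t ∈ ]0, γ]`, through §4 at base point `t`.
[cite: Balaban1987RG1, (2.9)-(2.12) pp.266-267; Balaban1988RG2Cluster, (2.14) p.15] -/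
theorem term214_windowDilated_basePoint {ι D : Type*} [DecidableEq ι] [DecidableEq D] (rr : ℝ) (lZ : List ι)
    (lD : List D) (A : (ι → ℂ) → Matrix Λ Λ ℂ) (Γ : (ι → ℂ) → (Λ ⊕ C₀ → ℝ) → (Λ → ℂ)) (cardP : ℕ)
    {χ₀ χc₀ χ₁ χc₁ : (Λ → ℝ) → ℝ} (Dfam : Finset D) {W₀ O₀ W₁ O₁ : D → (Λ → ℝ) → ℂ} {r : ℝ} (hr : r ≠ 0) (b : ℂ)
    (hχ : ∀ B, χ₁ B = χ₀ (r • B)) (hχc : ∀ B, χc₁ B = χc₀ (r • B))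
    (hW : ∀ Y B, ((r : ℂ) * b) ^ 2 * W₁ Y B = b ^ 2 * W₀ Y (r • B)) (hO : ∀ Y B, O₁ Y B = O₀ Y (r • B))
    (σ₀ : ι → ℂ) (τ₀ : D → ℂ) :
    term214 rr lZ lD (core214 (fun σ => ((r : ℂ) * b) ^ 2 • A σ) (fun σ X => ((r : ℂ) * b) • Γ σ X)
        (F214 cardP χ₁ χc₁ Dfam (fun Y B => ((r : ℂ) * b) ^ 2 * W₁ Y B + O₁ Y B))) σ₀ τ₀
      = term214 rr lZ lD (core214 (fun σ => b ^ 2 • A σ) (fun σ X => b • Γ σ X)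
        (F214 cardP χ₀ χc₀ Dfam (fun Y B => b ^ 2 * W₀ Y B + O₀ Y B))) σ₀ τ₀ := by
  have h : (fun τ B => F214 cardP χ₁ χc₁ Dfam (fun Y B => ((r : ℂ) * b) ^ 2 * W₁ Y B + O₁ Y B) τ (r⁻¹ • B))
      = F214 cardP χ₀ χc₀ Dfam (fun Y B => b ^ 2 * W₀ Y B + O₀ Y B) :=
    funext fun τ => funext fun B => by
      rw [F214_basePoint cardP Dfam b τ hχ hχc hW hO, smul_smul, mul_inv_cancel₀ hr, one_smul]
  rw [term214_dilate_family rr lZ lD A Γ _ hr b σ₀ τ₀, h]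

end BasePoint

/-! ## §7 (v1.1, append-only). The real-window agreement: under dilation covariance of the last-line data, the (2.14)
display at coupling `s` IS the window-dilated family at the REAL member `b = s₀/s` -/

section Agreement

variable {C₀ : Type} [Fintype C₀] [DecidableEq C₀]

omit [Fintype Λ] [DecidableEq Λ] in
/-- **The printed last line at coupling `s` read from the base point `s₀`.**  If the characteristic functions and the
potentials at coupling `s` are those of the base point `s₀` read in the dilated field — `χ_s(B) = χ_{s₀}(r⁻¹B)`,
`𝐕_s(Y,B) = r²·W(Y, r⁻¹B) + O(Y, r⁻¹B)` with `r = s₀/s` (thresholds in the dilated field `B′ = g_kB`, Wilson part `× g_k⁻²`,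
older terms by evaluation: [I] (2.9)–(2.12)) — then the last line of (2.14) at `s` is the last line of the `s₀`-family at the
real member `b = r`, at the dilated field. [cite: Balaban1987RG1, (2.9)-(2.12) pp.266-267; Balaban1988RG2Cluster, (2.14) p.15] -/
theorem F214_dilationCovariant {D : Type*} (cardP : ℕ) {χ χc χ₀ χc₀ : (Λ → ℝ) → ℝ} (Dfam : Finset D)
    {V W O : D → (Λ → ℝ) → ℂ} {r : ℝ} (τ : D → ℂ)
    (hχ : ∀ B, χ B = χ₀ (r⁻¹ • B)) (hχc : ∀ B, χc B = χc₀ (r⁻¹ • B))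
    (hV : ∀ Y B, V Y B = (r : ℂ) ^ 2 * W Y (r⁻¹ • B) + O Y (r⁻¹ • B)) (B : Λ → ℝ) :
    F214 cardP χ χc Dfam V τ B = F214 cardP χ₀ χc₀ Dfam (fun Y B => (r : ℂ) ^ 2 * W Y B + O Y B) τ (r⁻¹ • B) := by
  simp only [F214, hχ, hχc, hV]

/-- **THE REAL-WINDOW AGREEMENT (`hagree`)**: under the dilation covariance of `F214_dilationCovariant` (real ratio
`r = s₀/s ≠ 0`), the (2.14) term at coupling `s` — kernels `A`, `Γ` (coupling-blind), last line `χ_s, χᶜ_s, 𝐕_s` — EQUALS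
the window-dilated family of the base point `s₀` at the REAL member `b = r` (`term214_dilate` + `F214_dilationCovariant`).
With `term214_windowDilated_basePoint` this makes `u ↦ member_{s₀}(s₀/u)` a continuation of the keyed display off the whole
real window — node N22's `hagree` — PROVIDED the producer's datum carries the coupling exactly by the dilation (a displayed
law of the datum, not asserted here). [cite: Balaban1987RG1, (2.9)-(2.12) pp.266-267; Balaban1988RG2Cluster, (2.14) p.15] -/
theorem term214_eq_windowDilated_of_dilationCovariant {ι D : Type*} [DecidableEq ι] [DecidableEq D] (rr : ℝ)
    (lZ : List ι) (lD : List D) (A : (ι → ℂ) → Matrix Λ Λ ℂ) (Γ : (ι → ℂ) → (Λ ⊕ C₀ → ℝ) → (Λ → ℂ)) (cardP : ℕ)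
    {χ χc χ₀ χc₀ : (Λ → ℝ) → ℝ} (Dfam : Finset D) {V W O : D → (Λ → ℝ) → ℂ} {r : ℝ} (hr : r ≠ 0)
    (hχ : ∀ B, χ B = χ₀ (r⁻¹ • B)) (hχc : ∀ B, χc B = χc₀ (r⁻¹ • B))
    (hV : ∀ Y B, V Y B = (r : ℂ) ^ 2 * W Y (r⁻¹ • B) + O Y (r⁻¹ • B)) (σ₀ : ι → ℂ) (τ₀ : D → ℂ) :
    term214 rr lZ lD (core214 A Γ (F214 cardP χ χc Dfam V)) σ₀ τ₀
      = term214 rr lZ lD (core214 (fun σ => (r : ℂ) ^ 2 • A σ) (fun σ X => (r : ℂ) • Γ σ X)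
          (F214 cardP χ₀ χc₀ Dfam (fun Y B => (r : ℂ) ^ 2 * W Y B + O Y B))) σ₀ τ₀ := by
  have hF : F214 cardP χ χc Dfam V
      = fun τ B => F214 cardP χ₀ χc₀ Dfam (fun Y B => (r : ℂ) ^ 2 * W Y B + O Y B) τ (r⁻¹ • B) :=
    funext fun τ => funext fun B => F214_dilationCovariant cardP Dfam τ hχ hχc hV B
  rw [term214_dilate rr lZ lD A Γ _ hr σ₀ τ₀, hF]

end Agreement

end Literature.MathematicalPhysics.QuantumFieldTheory.Balaban1983to89.B13Term214WindowDilated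

end
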